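import Mathlib.Analysis.ODE.Gronwall
import Literature.Analysis.FluidPDE.CompressibleEulerCommutators
import Literature.Analysis.FluidPDE.SymmetrizedEnergyDerivBound
import Literature.Analysis.FunctionSpaces.TorusSobolevSup
import HarnessLib

/-!
# A-priori `H^m` bounds from `C¹` bounds for the non-isentropic compressible Euler equations on `𝕋³`
# (the analytic half of the continuation principle)

Analysis/FluidPDE support file (definitions with proved API; no named facts). The estimate behind
the continuation principle of Majda 1984, Ch. 2 §2.1, Thm 2.2 / Dafermos 2005, Thm 5.1.1 for the
monatomic law `p = ρϑζ(ρ)`, `e = 3ϑ/2`: a classical solution on `[0, T) × 𝕋³` whose state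
`(ρ, ϑ)` stays in a compact subset `K` of the hyperbolicity region `{ρ > 0, ϑ > 0, (ρζ)' > 0}` and
whose `C¹` norm (`‖u‖`, `|∇ρ|`, `‖∇u‖`, `|∇ϑ|`) stays bounded by `M` has ALL spatial word
derivatives bounded on `[0, T) × 𝕋³`, uniformly in time
(`IsClassicalEulerSolution.spatialWordBounds_of_C1`). The proof is the `H^m` energy method by
induction on `m`:

* `wordEnergy`, `levelEnergy` — the unweighted `L²` energies `N_w = ‖∂^wρ‖² + Σₖ‖∂^wuₖ‖² + ‖∂^wϑ‖²`
  and `E_m = Σ_{|w| ≤ m} N_w`; `weightedWordEnergy` — the symmetrised energy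
  `∫ (A (∂^wρ)² + ρ |∂^wu|² + C (∂^wϑ)²)`, `A = ϑ(ρζ)'/ρ`, `C = 3ρ/(2ϑ)`, equivalent to `N_w` on `K`;
* the differentiated system and its commutators are `CompressibleEulerCommutators.continuity_word`
  etc.; the energy inequality is `SymmetrizedEnergyDerivBound.abs_integral_timeDerivWithin_energy_le`;
  the commutators are bounded in `L²` linearly in `E_m^{1/2}` by the per-monomial bound
  `DiffMonomial.sqrt_integral_eval_sq_le` (sup bounds of orders `≤ m - 3` and `L²` bounds of
  orders `≤ m - 1` from the induction hypothesis through the Sobolev inequality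
  `Torus.norm_sq_le_sobolev_two_of_isSmooth`, the one sup factor of order `m - 2` again by Sobolev
  at level `m`);
* Grönwall (`norm_le_gronwallBound_of_norm_deriv_right_le`) on `[0, τ]` for every `τ < T`, with
  constants independent of `τ`.

## References

* A. Majda, *Compressible Fluid Flow and Systems of Conservation Laws in Several Space
  Variables*, Springer 1984, Ch. 2 §2.1, Thm 2.2 and (2.38). [Majda1984]
* C. M. Dafermos, *Hyperbolic Conservation Laws in Continuum Physics*, 2nd ed., Springer 2005,
  §5.1, Thm 5.1.1, (5.1.25). [Dafermos2005]
-/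

noncomputable section

open Set Function MeasureTheory Filter
open scoped ContDiff Topology

namespace Literature.Analysis.FluidPDE

namespace CompressibleEuler

open Literature.Analysis.FunctionSpaces Literature.Analysis.FunctionSpaces.Torus
open Literature.Analysis.FunctionSpaces.Torus.DiffMonomial

/-- Notation for the flat 3-torus. -/
local notation "𝕋³" => UnitAddTorus (Fin 3)
/-- Notation for Euclidean 3-space. -/
local notation "ℝ³" => EuclideanSpace ℝ (Fin 3)

variable {ζ f : ℝ → ℝ} {ρ ϑ : ℝ → 𝕋³ → ℝ} {u : ℝ → 𝕋³ → ℝ³}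

/-! ### The energies -/

/-- **Unweighted `L²` energy of the word derivative `∂^w`** at time `t`:
`N_w(t) = ∫ (∂^wρ)² + Σₖ ∫ (∂^wuₖ)² + ∫ (∂^wϑ)²`. [cite: Majda1984, Ch. 2 §2.1 Thm 2.2] -/
def wordEnergy (ρ : ℝ → 𝕋³ → ℝ) (u : ℝ → 𝕋³ → ℝ³) (ϑ : ℝ → 𝕋³ → ℝ) (w : List (Fin 3)) (t : ℝ) : ℝ :=
  (∫ y, iterPartialDeriv w (ρ t) y ^ 2) + (∑ k, ∫ y, iterPartialDeriv w (fun y => u t y k) y ^ 2) +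
    ∫ y, iterPartialDeriv w (ϑ t) y ^ 2

/-- **The level-`m` energy** `E_m(t) = Σ_{|w| ≤ m} N_w(t)` (`‖(ρ,u,ϑ)(t)‖²_{H^m}` written with all
words). [cite: Majda1984, Ch. 2 §2.1 Thm 2.2] -/
def levelEnergy (ρ : ℝ → 𝕋³ → ℝ) (u : ℝ → 𝕋³ → ℝ³) (ϑ : ℝ → 𝕋³ → ℝ) (m : ℕ) (t : ℝ) : ℝ :=
  ∑ n ∈ Finset.range (m + 1), ∑ w : Fin n → Fin 3, wordEnergy ρ u ϑ (List.ofFn w) t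

/-- The weight `C(ρ,ϑ) = ρ e_ϑ/ϑ = 3ρ/(2ϑ)` of the temperature in the symmetriser.
[cite: Majda1984, Ch. 2 §2.1 (2.9)] -/
def Ccoef (r θ : ℝ) : ℝ := 3 / 2 * r / θ

/-- **The symmetrised energy of the word derivative `∂^w`**:
`∫ (A(ρ,ϑ) (∂^wρ)² + ρ Σₖ(∂^wuₖ)² + C(ρ,ϑ) (∂^wϑ)²)`. [cite: Majda1984, Ch. 2 §2.1 (2.9)–(2.10)] -/
def weightedWordEnergy (ζ : ℝ → ℝ) (ρ : ℝ → 𝕋³ → ℝ) (u : ℝ → 𝕋³ → ℝ³) (ϑ : ℝ → 𝕋³ → ℝ)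
    (w : List (Fin 3)) (t : ℝ) : ℝ :=
  ∫ y, (Acoef ζ (ρ t y) (ϑ t y) * iterPartialDeriv w (ρ t) y ^ 2 +
    ρ t y * (∑ k, iterPartialDeriv w (fun y => u t y k) y ^ 2) +
    Ccoef (ρ t y) (ϑ t y) * iterPartialDeriv w (ϑ t) y ^ 2)

/-- **The symmetrised level-`m` energy.** [cite: Majda1984, Ch. 2 §2.1 Thm 2.2] -/
def weightedLevelEnergy (ζ : ℝ → ℝ) (ρ : ℝ → 𝕋³ → ℝ) (u : ℝ → 𝕋³ → ℝ³) (ϑ : ℝ → 𝕋³ → ℝ)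
    (m : ℕ) (t : ℝ) : ℝ :=
  ∑ n ∈ Finset.range (m + 1), ∑ w : Fin n → Fin 3, weightedWordEnergy ζ ρ u ϑ (List.ofFn w) t

/-- `N_w ≥ 0`. [folklore] -/
theorem wordEnergy_nonneg (w : List (Fin 3)) (t : ℝ) : 0 ≤ wordEnergy ρ u ϑ w t :=
  add_nonneg (add_nonneg (integral_nonneg fun _ => sq_nonneg _)
    (Finset.sum_nonneg fun _ _ => integral_nonneg fun _ => sq_nonneg _)) (integral_nonneg fun _ => sq_nonneg _)

/-- `E_m ≥ 0`. [folklore] -/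
theorem levelEnergy_nonneg (m : ℕ) (t : ℝ) : 0 ≤ levelEnergy ρ u ϑ m t :=
  Finset.sum_nonneg fun _ _ => Finset.sum_nonneg fun _ _ => wordEnergy_nonneg _ _

/-- A single word is dominated by the level energy. [folklore] -/
theorem wordEnergy_le_levelEnergy {w : List (Fin 3)} {m : ℕ} (hw : w.length ≤ m) (t : ℝ) :
    wordEnergy ρ u ϑ w t ≤ levelEnergy ρ u ϑ m t := by
  unfold levelEnergy
  have h1 : wordEnergy ρ u ϑ w t = wordEnergy ρ u ϑ (List.ofFn w.get) t := by rw [List.ofFn_get]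
  rw [h1]
  calc wordEnergy ρ u ϑ (List.ofFn w.get) t
      ≤ ∑ w' : Fin w.length → Fin 3, wordEnergy ρ u ϑ (List.ofFn w') t :=
        Finset.single_le_sum (f := fun w' : Fin w.length → Fin 3 => wordEnergy ρ u ϑ (List.ofFn w') t)
          (fun _ _ => wordEnergy_nonneg _ _) (Finset.mem_univ w.get)
    _ ≤ ∑ n ∈ Finset.range (m + 1), ∑ w' : Fin n → Fin 3, wordEnergy ρ u ϑ (List.ofFn w') t :=
        Finset.single_le_sum (f := fun n => ∑ w' : Fin n → Fin 3, wordEnergy ρ u ϑ (List.ofFn w') t)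
          (fun _ _ => Finset.sum_nonneg fun _ _ => wordEnergy_nonneg _ _)
          (Finset.mem_range.2 (Nat.lt_succ_of_le hw))

/-- The level energy is monotone in the level. [folklore] -/
theorem levelEnergy_mono {m m' : ℕ} (h : m ≤ m') (t : ℝ) :
    levelEnergy ρ u ϑ m t ≤ levelEnergy ρ u ϑ m' t :=
  Finset.sum_le_sum_of_subset_of_nonneg (Finset.range_mono (by omega))
    fun _ _ _ => Finset.sum_nonneg fun _ _ => wordEnergy_nonneg _ _

/-- The number of words of length `≤ m` over three letters, as a real number (`Σ_{n ≤ m} 3ⁿ`).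
[folklore] -/
def levelCount (m : ℕ) : ℝ := ∑ n ∈ Finset.range (m + 1), ((Finset.univ : Finset (Fin n → Fin 3)).card : ℝ)

/-- `levelCount m ≥ 0`. [folklore] -/
theorem levelCount_nonneg (m : ℕ) : 0 ≤ levelCount m := Finset.sum_nonneg fun _ _ => Nat.cast_nonneg _

/-- `levelCount m ≥ 1` (the empty word). [folklore] -/
theorem one_le_levelCount (m : ℕ) : 1 ≤ levelCount m := by
  unfold levelCount
  have h0 : (0 : ℕ) ∈ Finset.range (m + 1) := Finset.mem_range.2 (Nat.succ_pos m)
  have := Finset.single_le_sum (f := fun n => ((Finset.univ : Finset (Fin n → Fin 3)).card : ℝ))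
    (fun n _ => Nat.cast_nonneg _) h0
  refine le_trans ?_ this
  simp

/-- `L²` norms of single components are dominated by the level energy: density. [folklore] -/
theorem integral_sq_rho_le {w : List (Fin 3)} {m : ℕ} (hw : w.length ≤ m) (t : ℝ) :
    ∫ y, iterPartialDeriv w (ρ t) y ^ 2 ≤ levelEnergy ρ u ϑ m t := by
  refine le_trans ?_ (wordEnergy_le_levelEnergy hw t)
  have hs : 0 ≤ ∑ k, ∫ y, iterPartialDeriv w (fun y => u t y k) y ^ 2 :=
    Finset.sum_nonneg fun k _ => integral_nonneg fun y => sq_nonneg _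
  have hθ : 0 ≤ ∫ y, iterPartialDeriv w (ϑ t) y ^ 2 := integral_nonneg fun y => sq_nonneg _
  unfold wordEnergy
  linarith

/-- `L²` norms of single components are dominated by the level energy: velocity. [folklore] -/
theorem integral_sq_vel_le {w : List (Fin 3)} {m : ℕ} (hw : w.length ≤ m) (t : ℝ) (k : Fin 3) :
    ∫ y, iterPartialDeriv w (fun y => u t y k) y ^ 2 ≤ levelEnergy ρ u ϑ m t := by
  refine le_trans ?_ (wordEnergy_le_levelEnergy hw t)
  have h1 : ∫ y, iterPartialDeriv w (fun y => u t y k) y ^ 2 ≤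
      ∑ k, ∫ y, iterPartialDeriv w (fun y => u t y k) y ^ 2 :=
    Finset.single_le_sum (f := fun k => ∫ y, iterPartialDeriv w (fun y => u t y k) y ^ 2)
      (fun _ _ => integral_nonneg fun _ => sq_nonneg _) (Finset.mem_univ k)
  have hρ : 0 ≤ ∫ y, iterPartialDeriv w (ρ t) y ^ 2 := integral_nonneg fun y => sq_nonneg _
  have hθ : 0 ≤ ∫ y, iterPartialDeriv w (ϑ t) y ^ 2 := integral_nonneg fun y => sq_nonneg _
  unfold wordEnergy
  linarith

/-- `L²` norms of single components are dominated by the level energy: temperature. [folklore] -/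
theorem integral_sq_theta_le {w : List (Fin 3)} {m : ℕ} (hw : w.length ≤ m) (t : ℝ) :
    ∫ y, iterPartialDeriv w (ϑ t) y ^ 2 ≤ levelEnergy ρ u ϑ m t := by
  refine le_trans ?_ (wordEnergy_le_levelEnergy hw t)
  have hs : 0 ≤ ∑ k, ∫ y, iterPartialDeriv w (fun y => u t y k) y ^ 2 :=
    Finset.sum_nonneg fun k _ => integral_nonneg fun y => sq_nonneg _
  have hρ : 0 ≤ ∫ y, iterPartialDeriv w (ρ t) y ^ 2 := integral_nonneg fun y => sq_nonneg _
  unfold wordEnergy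
  linarith

/-- All five fields at once: `∫ (∂^w φ_k)² ≤ E_m` for `|w| ≤ m`. [folklore] -/
theorem integral_sq_primFields_le {w : List (Fin 3)} {m : ℕ} (hw : w.length ≤ m) (t : ℝ) :
    ∀ k : PIdx, ∫ y, iterPartialDeriv w (primFields ρ u ϑ t k) y ^ 2 ≤ levelEnergy ρ u ϑ m t
  | none => integral_sq_rho_le hw t
  | some none => integral_sq_theta_le hw t
  | some (some k) => integral_sq_vel_le hw t k

/-! ### Sobolev: sup bounds of order `n` from the level-`(n+2)` energy -/

/-- **Sup bounds by Sobolev**: there is `K_S > 0` with `|∂^v φ_k(t, x)|² ≤ K_S · E_{|v|+2}(t)` for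
all five fields, all words and all times at which the fields are smooth.
[cite: Majda1984, Ch. 2 §2.1 Thm 2.2] -/
theorem exists_sobolev_const :
    ∃ KS : ℝ, 0 < KS ∧ ∀ (ρ ϑ : ℝ → 𝕋³ → ℝ) (u : ℝ → 𝕋³ → ℝ³) (t : ℝ),
      (∀ k, IsSmooth (primFields ρ u ϑ t k)) →
      ∀ (k : PIdx) (v : List (Fin 3)) (x : 𝕋³),
        iterPartialDeriv v (primFields ρ u ϑ t k) x ^ 2 ≤ KS * levelEnergy ρ u ϑ (v.length + 2) t := by
  obtain ⟨K, hK, hS⟩ := norm_sq_le_sobolev_two_of_isSmooth (d := Fin 3) (F' := ℝ) (by simp)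
  refine ⟨13 * K, by positivity, fun ρ ϑ u t hsm k v x => ?_⟩
  set g : 𝕋³ → ℝ := iterPartialDeriv v (primFields ρ u ϑ t k) with hg
  have hgs : IsSmooth g := (hsm k).iterPartialDeriv v
  have h := hS g hgs x
  simp only [Real.norm_eq_abs, sq_abs] at h
  set E := levelEnergy ρ u ϑ (v.length + 2) t with hE
  have h0 : ∫ y, g y ^ 2 ≤ E := integral_sq_primFields_le (by omega) t k
  have h1 : ∀ i, ∫ y, partialDeriv i g y ^ 2 ≤ E := fun i => by
    have := integral_sq_primFields_le (ρ := ρ) (u := u) (ϑ := ϑ) (w := i :: v) (m := v.length + 2)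
      (by simp) t k
    simpa [iterPartialDeriv_cons] using this
  have h2 : ∀ i j, ∫ y, partialDeriv i (partialDeriv j g) y ^ 2 ≤ E := fun i j => by
    have := integral_sq_primFields_le (ρ := ρ) (u := u) (ϑ := ϑ) (w := i :: j :: v) (m := v.length + 2)
      (by simp) t k
    simpa [iterPartialDeriv_cons] using this
  have hs1 : ∑ i, ∫ y, partialDeriv i g y ^ 2 ≤ 3 * E := by
    calc ∑ i, ∫ y, partialDeriv i g y ^ 2 ≤ ∑ _i : Fin 3, E := Finset.sum_le_sum fun i _ => h1 i
      _ = 3 * E := by simp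
  have hs2 : ∑ i, ∑ j, ∫ y, partialDeriv i (partialDeriv j g) y ^ 2 ≤ 9 * E := by
    calc ∑ i, ∑ j, ∫ y, partialDeriv i (partialDeriv j g) y ^ 2 ≤ ∑ _i : Fin 3, ∑ _j : Fin 3, E :=
          Finset.sum_le_sum fun i _ => Finset.sum_le_sum fun j _ => h2 i j
      _ = 9 * E := by simp; ring
  calc g x ^ 2 ≤ K * ((∫ y, g y ^ 2) + (∑ i, ∫ y, partialDeriv i g y ^ 2) +
        ∑ i, ∑ j, ∫ y, partialDeriv i (partialDeriv j g) y ^ 2) := h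
    _ ≤ K * (E + 3 * E + 9 * E) := by gcongr
    _ = 13 * K * E := by ring

/-! ### Restriction of a primitive solution to a closed sub-interval -/

/-- One-sided time derivatives within `[0, τ] ⊆ [0, T)` agree with those within `[0, T)` for
jointly smooth fields. [folklore] -/
theorem timeDerivWithin_Icc_eq_of_Ico {F : Type*} [NormedAddCommGroup F] [NormedSpace ℝ F]
    {T τ : ℝ} (hτ : 0 < τ) (hτT : τ < T) {φ : ℝ → 𝕋³ → F} (hφ : IsSmoothSpaceTimeOn (Ico 0 T) φ)
    {t : ℝ} (ht : t ∈ Icc 0 τ) (x : 𝕋³) :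
    timeDerivWithin (Icc 0 τ) φ t x = timeDerivWithin (Ico 0 T) φ t x := by
  have hsub : Icc 0 τ ⊆ Ico 0 T := Icc_subset_Ico_right hτT
  exact ((hφ.hasDerivWithinAt_slice (hsub ht) x).mono hsub).derivWithin (uniqueDiffOn_Icc hτ t ht)

/-- **Restriction of a primitive solution on `[0, T)` to `[0, τ]`, `0 < τ < T`.**
[cite: Majda1984, Ch. 2 §2.1] -/
theorem IsPrimitiveEulerSolutionOn.restrict_Icc {T τ : ℝ} (hτ : 0 < τ) (hτT : τ < T)
    (h : IsPrimitiveEulerSolutionOn (EulerEOS.monatomicExcess ζ f) (Ico 0 T) ρ u ϑ) :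
    IsPrimitiveEulerSolutionOn (EulerEOS.monatomicExcess ζ f) (Icc 0 τ) ρ u ϑ := by
  have hsub : Icc 0 τ ⊆ Ico 0 T := Icc_subset_Ico_right hτT
  have he : IsSmoothSpaceTimeOn (Ico 0 T) fun s y => (EulerEOS.monatomicExcess ζ f).e (ρ s y) (ϑ s y) := by
    show IsSmoothSpaceTimeOn (Ico 0 T) fun s y => 3 / 2 * ϑ s y
    exact h.smooth_temperature.const_smul (3 / 2)
  exact
    { smooth_density := h.smooth_density.mono hsub
      smooth_velocity := h.smooth_velocity.mono hsub
      smooth_temperature := h.smooth_temperature.mono hsub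
      density_pos := fun t ht => h.density_pos t (hsub ht)
      temperature_pos := fun t ht => h.temperature_pos t (hsub ht)
      continuity := fun t ht x => by
        rw [timeDerivWithin_Icc_eq_of_Ico hτ hτT h.smooth_density ht x]; exact h.continuity t (hsub ht) x
      euler := fun t ht x => by
        rw [timeDerivWithin_Icc_eq_of_Ico hτ hτT h.smooth_velocity ht x]; exact h.euler t (hsub ht) x
      ienergy := fun t ht x => by
        rw [timeDerivWithin_Icc_eq_of_Ico hτ hτT he ht x]; exact h.ienergy t (hsub ht) x }

/-! ### The weights: positivity and bounds on the compact state set -/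

/-- `(ρζ)' = ζ + ρζ'`. [folklore] -/
theorem deriv_mul_zeta (hζ : ContDiff ℝ ∞ ζ) (r : ℝ) :
    deriv (fun s => s * ζ s) r = ζ r + r * deriv ζ r := by
  have hd : DifferentiableAt ℝ ζ r := (hζ.differentiable (by simp)).differentiableAt
  have h1 : HasDerivAt (fun s => s * ζ s) (1 * ζ r + r * deriv ζ r) r := (hasDerivAt_id' r).fun_mul hd.hasDerivAt
  rw [h1.deriv]; ring

/-- `C` is smooth on the quadrant. [folklore] -/
theorem contDiffOn_Ccoef : ContDiffOn ℝ ∞ (uncurry Ccoef) quadrant := by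
  have h : uncurry Ccoef = fun q : ℝ × ℝ => 3 / 2 * q.1 / q.2 := by funext ⟨r, θ⟩; rfl
  rw [h]
  exact (contDiffOn_const.mul contDiffOn_fst).div contDiffOn_snd fun q hq => (mem_prod.1 hq).2.ne'

/-- A continuous real function on a compact set is bounded in absolute value by some `B ≥ 1`.
[folklore] -/
theorem exists_abs_le_of_continuousOn {K : Set (ℝ × ℝ)} (hK : IsCompact K) {g : ℝ × ℝ → ℝ}
    (hg : ContinuousOn g K) : ∃ B : ℝ, 1 ≤ B ∧ ∀ z ∈ K, |g z| ≤ B := by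
  obtain ⟨B, hB⟩ := hK.exists_bound_of_continuousOn hg
  exact ⟨max B 1, le_max_right _ _, fun z hz => (hB z hz).trans (le_max_left _ _)⟩

/-- A continuous positive function on a compact set is bounded below by a positive constant.
[folklore] -/
theorem exists_pos_le_of_continuousOn {K : Set (ℝ × ℝ)} (hK : IsCompact K) {g : ℝ × ℝ → ℝ}
    (hg : ContinuousOn g K) (hpos : ∀ z ∈ K, 0 < g z) : ∃ c : ℝ, 0 < c ∧ ∀ z ∈ K, c ≤ g z := by
  by_cases hne : K.Nonempty
  · obtain ⟨z₀, hz₀, hmin⟩ := hK.exists_isMinOn hne hg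
    exact ⟨g z₀, hpos z₀ hz₀, fun z hz => hmin hz⟩
  · refine ⟨1, one_pos, fun z hz => (hne ⟨z, hz⟩).elim⟩

/-- **The symmetriser weights are uniformly positive and bounded on a compact subset of the
hyperbolicity region.** [cite: Majda1984, Ch. 2 §2.1 (2.9)] -/
theorem exists_weights_bounds (hζ : ContDiff ℝ ∞ ζ) {K : Set (ℝ × ℝ)} (hK : IsCompact K)
    (hKhyp : K ⊆ {z : ℝ × ℝ | 0 < z.1 ∧ 0 < z.2 ∧ 0 < deriv (fun s => s * ζ s) z.1}) :
    ∃ c₀ c₁ : ℝ, 0 < c₀ ∧ c₀ ≤ c₁ ∧ ∀ z ∈ K,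
      (c₀ ≤ Acoef ζ z.1 z.2 ∧ Acoef ζ z.1 z.2 ≤ c₁) ∧ (c₀ ≤ z.1 ∧ z.1 ≤ c₁) ∧
        (c₀ ≤ Ccoef z.1 z.2 ∧ Ccoef z.1 z.2 ≤ c₁) := by
  have hKq : K ⊆ quadrant := fun z hz => ⟨(hKhyp hz).1, (hKhyp hz).2.1⟩
  have hA : ContinuousOn (uncurry (Acoef ζ)) K := (contDiffOn_Acoef hζ).continuousOn.mono hKq
  have hC : ContinuousOn (uncurry Ccoef) K := contDiffOn_Ccoef.continuousOn.mono hKq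
  have hApos : ∀ z ∈ K, 0 < uncurry (Acoef ζ) z := by
    rintro ⟨r, θ⟩ hz
    obtain ⟨hr, hθ, hh⟩ : 0 < r ∧ 0 < θ ∧ 0 < deriv (fun s => s * ζ s) r := hKhyp hz
    rw [deriv_mul_zeta hζ] at hh
    show 0 < θ * (ζ r + r * deriv ζ r) / r
    exact div_pos (mul_pos hθ hh) hr
  have hCpos : ∀ z ∈ K, 0 < uncurry Ccoef z := by
    rintro ⟨r, θ⟩ hz
    obtain ⟨hr, hθ, -⟩ : 0 < r ∧ 0 < θ ∧ 0 < deriv (fun s => s * ζ s) r := hKhyp hz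
    show 0 < 3 / 2 * r / θ
    positivity
  obtain ⟨a₀, ha₀, ha⟩ := exists_pos_le_of_continuousOn hK hA hApos
  obtain ⟨b₀, hb₀, hb⟩ := exists_pos_le_of_continuousOn hK hC hCpos
  obtain ⟨r₀, hr₀, hr⟩ := exists_pos_le_of_continuousOn hK continuous_fst.continuousOn
    fun z hz => (hKhyp hz).1
  obtain ⟨A₁, hA₁1, hA₁⟩ := exists_abs_le_of_continuousOn hK hA
  obtain ⟨C₁, hC₁1, hC₁⟩ := exists_abs_le_of_continuousOn hK hC
  obtain ⟨R₁, hR₁1, hR₁⟩ := exists_abs_le_of_continuousOn hK continuous_fst.continuousOn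
  set c₀ := min a₀ (min b₀ r₀) with hc₀
  have hc₀a : c₀ ≤ a₀ := min_le_left _ _
  have hc₀b : c₀ ≤ b₀ := (min_le_right _ _).trans (min_le_left _ _)
  have hc₀r : c₀ ≤ r₀ := (min_le_right _ _).trans (min_le_right _ _)
  by_cases hne : K.Nonempty
  · obtain ⟨z₁, hz₁⟩ := hne
    have hc₀A : c₀ ≤ A₁ := hc₀a.trans ((ha z₁ hz₁).trans ((le_abs_self _).trans (hA₁ z₁ hz₁)))
    refine ⟨c₀, A₁ + C₁ + R₁, lt_min ha₀ (lt_min hb₀ hr₀), by linarith, fun z hz => ?_⟩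
    have e1 : uncurry (Acoef ζ) z = Acoef ζ z.1 z.2 := rfl
    have e2 : uncurry Ccoef z = Ccoef z.1 z.2 := rfl
    refine ⟨⟨hc₀a.trans (ha z hz), ?_⟩, ⟨hc₀r.trans (hr z hz), ?_⟩, ⟨hc₀b.trans (hb z hz), ?_⟩⟩
    · have := (le_abs_self _).trans (hA₁ z hz); rw [e1] at this; linarith
    · have := (le_abs_self _).trans (hR₁ z hz); linarith
    · have := (le_abs_self _).trans (hC₁ z hz); rw [e2] at this; linarith
  · refine ⟨c₀, c₀, lt_min ha₀ (lt_min hb₀ hr₀), le_rfl, fun z hz => (hne ⟨z, hz⟩).elim⟩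

/-- **Equivalence of the symmetrised and the plain energies**: if `c₀ ≤ A, ρ, C ≤ c₁` along the
state then `c₀ N_w ≤ W_w ≤ c₁ N_w`. [cite: Majda1984, Ch. 2 §2.1 (2.10)] -/
theorem weightedWordEnergy_compare (hζ : ContDiff ℝ ∞ ζ) {S : Set ℝ} {eos : EulerEOS}
    (h : IsPrimitiveEulerSolutionOn eos S ρ u ϑ)
    {c₀ c₁ : ℝ} (hw : ∀ t ∈ S, ∀ y,
      (c₀ ≤ Acoef ζ (ρ t y) (ϑ t y) ∧ Acoef ζ (ρ t y) (ϑ t y) ≤ c₁) ∧ (c₀ ≤ ρ t y ∧ ρ t y ≤ c₁) ∧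
        (c₀ ≤ Ccoef (ρ t y) (ϑ t y) ∧ Ccoef (ρ t y) (ϑ t y) ≤ c₁))
    (w : List (Fin 3)) {t : ℝ} (ht : t ∈ S) :
    c₀ * wordEnergy ρ u ϑ w t ≤ weightedWordEnergy ζ ρ u ϑ w t ∧
      weightedWordEnergy ζ ρ u ϑ w t ≤ c₁ * wordEnergy ρ u ϑ w t := by
  have hφs := isSmooth_primFields h ht
  have hφq := primFields_mem_quadrant h ht
  have cR : Continuous (iterPartialDeriv w (ρ t)) := ((hφs PIdx.rho).iterPartialDeriv w).continuous
  have cΘ : Continuous (iterPartialDeriv w (ϑ t)) := ((hφs PIdx.theta).iterPartialDeriv w).continuous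
  have cU : ∀ k, Continuous (iterPartialDeriv w (fun y => u t y k)) := fun k =>
    ((hφs (PIdx.vel k)).iterPartialDeriv w).continuous
  have cA : Continuous fun y => Acoef ζ (ρ t y) (ϑ t y) :=
    (isSmooth_coeffField (a := PIdx.rho) (b := PIdx.theta) hφs (contDiffOn_Acoef hζ) hφq).continuous
  have cC : Continuous fun y => Ccoef (ρ t y) (ϑ t y) :=
    (isSmooth_coeffField (a := PIdx.rho) (b := PIdx.theta) hφs contDiffOn_Ccoef hφq).continuous
  have cρ : Continuous (ρ t) := (hφs PIdx.rho).continuous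
  -- the plain integrand and its integral
  have cR2 : Continuous fun y => iterPartialDeriv w (ρ t) y ^ 2 := cR.pow 2
  have cΘ2 : Continuous fun y => iterPartialDeriv w (ϑ t) y ^ 2 := cΘ.pow 2
  have cU2 : ∀ k, Continuous fun y => iterPartialDeriv w (fun y => u t y k) y ^ 2 := fun k => (cU k).pow 2
  have cUs : Continuous fun y => ∑ k, iterPartialDeriv w (fun y => u t y k) y ^ 2 :=
    continuous_finsetSum _ fun k _ => cU2 k
  have cN12 : Continuous fun y => iterPartialDeriv w (ρ t) y ^ 2 + ∑ k, iterPartialDeriv w (fun y => u t y k) y ^ 2 :=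
    cR2.add cUs
  have cN : Continuous fun y => iterPartialDeriv w (ρ t) y ^ 2 +
      (∑ k, iterPartialDeriv w (fun y => u t y k) y ^ 2) + iterPartialDeriv w (ϑ t) y ^ 2 := cN12.add cΘ2
  have hN : wordEnergy ρ u ϑ w t = ∫ y, (iterPartialDeriv w (ρ t) y ^ 2 +
      (∑ k, iterPartialDeriv w (fun y => u t y k) y ^ 2) + iterPartialDeriv w (ϑ t) y ^ 2) := by
    unfold wordEnergy
    rw [integral_add cN12.integrable_unitAddTorus cΘ2.integrable_unitAddTorus,
      integral_add cR2.integrable_unitAddTorus cUs.integrable_unitAddTorus,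
      integral_finsetSum _ fun k _ => (cU2 k).integrable_unitAddTorus]
  have cW : Continuous fun y => Acoef ζ (ρ t y) (ϑ t y) * iterPartialDeriv w (ρ t) y ^ 2 +
      ρ t y * (∑ k, iterPartialDeriv w (fun y => u t y k) y ^ 2) +
      Ccoef (ρ t y) (ϑ t y) * iterPartialDeriv w (ϑ t) y ^ 2 :=
    ((cA.mul cR2).add (cρ.mul cUs)).add (cC.mul cΘ2)
  unfold weightedWordEnergy
  rw [hN, ← integral_const_mul, ← integral_const_mul]
  constructor
  · refine integral_mono ((continuous_const.mul cN).integrable_unitAddTorus) cW.integrable_unitAddTorus fun y => ?_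
    obtain ⟨⟨hA0, -⟩, ⟨hρ0, -⟩, ⟨hC0, -⟩⟩ := hw t ht y
    have h1 := sq_nonneg (iterPartialDeriv w (ρ t) y)
    have h2 : 0 ≤ ∑ k, iterPartialDeriv w (fun y => u t y k) y ^ 2 := Finset.sum_nonneg fun k _ => sq_nonneg _
    have h3 := sq_nonneg (iterPartialDeriv w (ϑ t) y)
    show c₀ * _ ≤ _
    nlinarith [mul_le_mul_of_nonneg_right hA0 h1, mul_le_mul_of_nonneg_right hρ0 h2,
      mul_le_mul_of_nonneg_right hC0 h3]
  · refine integral_mono cW.integrable_unitAddTorus ((continuous_const.mul cN).integrable_unitAddTorus) fun y => ?_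
    obtain ⟨⟨-, hA1⟩, ⟨-, hρ1⟩, ⟨-, hC1⟩⟩ := hw t ht y
    have h1 := sq_nonneg (iterPartialDeriv w (ρ t) y)
    have h2 : 0 ≤ ∑ k, iterPartialDeriv w (fun y => u t y k) y ^ 2 := Finset.sum_nonneg fun k _ => sq_nonneg _
    have h3 := sq_nonneg (iterPartialDeriv w (ϑ t) y)
    show _ ≤ c₁ * _
    nlinarith [mul_le_mul_of_nonneg_right hA1 h1, mul_le_mul_of_nonneg_right hρ1 h2,
      mul_le_mul_of_nonneg_right hC1 h3]

/-- The symmetrised integrand is jointly smooth. [folklore] -/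
theorem isSmoothSpaceTimeOn_weightedIntegrand (hζ : ContDiff ℝ ∞ ζ) {S : Set ℝ} (hS : UniqueDiffOn ℝ S)
    {eos : EulerEOS} (h : IsPrimitiveEulerSolutionOn eos S ρ u ϑ) (w : List (Fin 3)) :
    IsSmoothSpaceTimeOn S fun s y => Acoef ζ (ρ s y) (ϑ s y) * iterPartialDeriv w (ρ s) y ^ 2 +
      ρ s y * (∑ k, iterPartialDeriv w (fun y => u s y k) y ^ 2) +
      Ccoef (ρ s y) (ϑ s y) * iterPartialDeriv w (ϑ s) y ^ 2 := by
  have hA := isSmoothSpaceTimeOn_comp_quadrant (contDiffOn_Acoef hζ) h.smooth_density h.smooth_temperature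
    h.density_pos h.temperature_pos
  have hC := isSmoothSpaceTimeOn_comp_quadrant contDiffOn_Ccoef h.smooth_density h.smooth_temperature
    h.density_pos h.temperature_pos
  have hR := h.smooth_density.iterPartialDeriv hS w
  have hΘ := h.smooth_temperature.iterPartialDeriv hS w
  have hU : ∀ k, IsSmoothSpaceTimeOn S fun s => iterPartialDeriv w fun y => u s y k := fun k =>
    (h.smooth_velocity.apply k).iterPartialDeriv hS w
  have hU2 : ∀ k, IsSmoothSpaceTimeOn S fun s y => (iterPartialDeriv w (fun y => u s y k)) y ^ 2 := fun k => by
    simpa only [sq] using (hU k).mul (hU k)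
  have h1 : IsSmoothSpaceTimeOn S fun s y => Acoef ζ (ρ s y) (ϑ s y) * iterPartialDeriv w (ρ s) y ^ 2 := by
    simpa only [sq] using hA.mul (hR.mul hR)
  have h2 : IsSmoothSpaceTimeOn S fun s y => ρ s y * ∑ k, iterPartialDeriv w (fun y => u s y k) y ^ 2 :=
    h.smooth_density.mul (IsSmoothSpaceTimeOn.sum fun k _ => hU2 k)
  have h3 : IsSmoothSpaceTimeOn S fun s y => Ccoef (ρ s y) (ϑ s y) * iterPartialDeriv w (ϑ s) y ^ 2 := by
    simpa only [sq] using hC.mul (hΘ.mul hΘ)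
  exact (h1.add h2).add h3

/-- **The symmetrised energy is differentiable in time within the (convex) time set, with
derivative the integral of the time derivative of the integrand.** [folklore] -/
theorem hasDerivWithinAt_weightedWordEnergy (hζ : ContDiff ℝ ∞ ζ) {S : Set ℝ} (hS : UniqueDiffOn ℝ S)
    (hSc : Convex ℝ S) {eos : EulerEOS} (h : IsPrimitiveEulerSolutionOn eos S ρ u ϑ) (w : List (Fin 3))
    {t : ℝ} (ht : t ∈ S) :
    HasDerivWithinAt (weightedWordEnergy ζ ρ u ϑ w)
      (∫ y, timeDerivWithin S (fun s y => Acoef ζ (ρ s y) (ϑ s y) * iterPartialDeriv w (ρ s) y ^ 2 +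
        ρ s y * (∑ k, iterPartialDeriv w (fun y => u s y k) y ^ 2) +
        Ccoef (ρ s y) (ϑ s y) * iterPartialDeriv w (ϑ s) y ^ 2) t y) S t :=
  (isSmoothSpaceTimeOn_weightedIntegrand hζ hS h w).hasDerivWithinAt_integral hSc ht

/-- Components are bounded by the Euclidean norm. [folklore] -/
theorem abs_apply_le_norm (v : ℝ³) (i : Fin 3) : |v i| ≤ ‖v‖ := by
  simpa using PiLp.norm_apply_le v i

/-- **The energy inequality for the word derivatives of a primitive Euler solution.** With
`Λ ≥ 1` bounding, along the solution, `|ρ|, |ϑ|, ‖u‖`, the first space derivatives of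
`ρ, u, ϑ`, and the values of `A, ∂A, C, ∂C, ζ, ζ', D` at the state, the symmetrised energy of
`∂^w` satisfies `|W_w'| ≤ (L + 18L²) N_w + 2L (‖∂^wρ‖‖F_w‖ + Σₖ ‖∂^wuₖ‖‖G_{k,w}‖ + ‖∂^wϑ‖‖H_w‖)`,
`L = 12Λ³`, with the commutators `F_w, G_{k,w}, H_w` of `CompressibleEulerCommutators`.
[cite: Majda1984, Ch. 2 §2.1 Thm 2.2] -/
theorem abs_integral_timeDerivWithin_weighted_le (hζ : ContDiff ℝ ∞ ζ) {a b : ℝ} (hab : a < b)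
    (h : IsPrimitiveEulerSolutionOn (EulerEOS.monatomicExcess ζ f) (Icc a b) ρ u ϑ)
    {Λ : ℝ} (hΛ1 : 1 ≤ Λ)
    (hKb : ∀ t ∈ Icc a b, ∀ y, |ρ t y| ≤ Λ ∧ |ϑ t y| ≤ Λ ∧ |Acoef ζ (ρ t y) (ϑ t y)| ≤ Λ ∧
      |dR (Acoef ζ) (ρ t y) (ϑ t y)| ≤ Λ ∧ |dT (Acoef ζ) (ρ t y) (ϑ t y)| ≤ Λ ∧
      |Ccoef (ρ t y) (ϑ t y)| ≤ Λ ∧ |dR Ccoef (ρ t y) (ϑ t y)| ≤ Λ ∧ |dT Ccoef (ρ t y) (ϑ t y)| ≤ Λ ∧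
      |ζ (ρ t y)| ≤ Λ ∧ |deriv ζ (ρ t y)| ≤ Λ ∧ |Dcoef ζ (ρ t y) (ϑ t y)| ≤ Λ)
    (hMb : ∀ t ∈ Icc a b, ∀ y, ‖u t y‖ ≤ Λ ∧ ∀ i, |partialDeriv i (ρ t) y| ≤ Λ ∧
      ‖partialDeriv i (u t) y‖ ≤ Λ ∧ |partialDeriv i (ϑ t) y| ≤ Λ)
    (w : List (Fin 3)) {t : ℝ} (ht : t ∈ Icc a b) :
    |∫ y, timeDerivWithin (Icc a b) (fun s y => Acoef ζ (ρ s y) (ϑ s y) * iterPartialDeriv w (ρ s) y ^ 2 +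
        ρ s y * (∑ k, iterPartialDeriv w (fun y => u s y k) y ^ 2) +
        Ccoef (ρ s y) (ϑ s y) * iterPartialDeriv w (ϑ s) y ^ 2) t y| ≤
      (12 * Λ ^ 3 + 18 * (12 * Λ ^ 3) ^ 2) * wordEnergy ρ u ϑ w t +
        2 * (12 * Λ ^ 3) * (Real.sqrt (∫ y, iterPartialDeriv w (ρ t) y ^ 2) *
            Real.sqrt (∫ y, ((FF w).map fun T => T.eval (primFields ρ u ϑ t) PIdx.rho PIdx.theta y).sum ^ 2) +
          (∑ k, Real.sqrt (∫ y, iterPartialDeriv w (fun y => u t y k) y ^ 2) *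
            Real.sqrt (∫ y, ((GG ζ k w).map fun T => T.eval (primFields ρ u ϑ t) PIdx.rho PIdx.theta y).sum ^ 2)) +
          Real.sqrt (∫ y, iterPartialDeriv w (ϑ t) y ^ 2) *
            Real.sqrt (∫ y, ((HH ζ w).map fun T => T.eval (primFields ρ u ϑ t) PIdx.rho PIdx.theta y).sum ^ 2)) := by
  have hS : UniqueDiffOn ℝ (Icc a b) := uniqueDiffOn_Icc hab
  have hΛ0 : 0 ≤ Λ := zero_le_one.trans hΛ1
  set L : ℝ := 12 * Λ ^ 3 with hL
  have hΛL : Λ ≤ L := by rw [hL]; nlinarith [hΛ1, sq_nonneg Λ, mul_nonneg hΛ0 (sq_nonneg Λ)]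
  have hΛ2L : 2 * Λ ^ 2 ≤ L := by rw [hL]; nlinarith [hΛ1, sq_nonneg Λ]
  have hΛ6L : 6 * Λ ^ 2 ≤ L := by rw [hL]; nlinarith [hΛ1, sq_nonneg Λ]
  have hL0 : 0 ≤ L := hΛ0.trans hΛL
  -- smoothness
  have hρ := h.smooth_density; have hϑ := h.smooth_temperature; have hu := h.smooth_velocity
  have hA := isSmoothSpaceTimeOn_comp_quadrant (contDiffOn_Acoef hζ) hρ hϑ h.density_pos h.temperature_pos
  have hC := isSmoothSpaceTimeOn_comp_quadrant contDiffOn_Ccoef hρ hϑ h.density_pos h.temperature_pos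
  have hD := isSmoothSpaceTimeOn_comp_quadrant (contDiffOn_Dcoef hζ) hρ hϑ h.density_pos h.temperature_pos
  have hZ : IsSmoothSpaceTimeOn (Icc a b) fun s y => Zcoef ζ (ρ s y) (ϑ s y) :=
    isSmoothSpaceTimeOn_comp_quadrant (contDiffOn_Zcoef hζ) hρ hϑ h.density_pos h.temperature_pos
  have hR := hρ.iterPartialDeriv hS w
  have hΘ := hϑ.iterPartialDeriv hS w
  have hU : ∀ k, IsSmoothSpaceTimeOn (Icc a b) fun s => iterPartialDeriv w fun y => u s y k := fun k =>
    (hu.apply k).iterPartialDeriv hS w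
  have huu : ∀ i, IsSmoothSpaceTimeOn (Icc a b) fun s y => u s y i := fun i => hu.apply i
  have hφs : ∀ k, IsSmooth (primFields ρ u ϑ t k) := isSmooth_primFields h ht
  have hφq := primFields_mem_quadrant h ht
  have hρ1 : IsContDiff 1 (ρ t) := (hφs PIdx.rho).isContDiff (by simp)
  have hϑ1 : IsContDiff 1 (ϑ t) := (hφs PIdx.theta).isContDiff (by simp)
  have hu1 : IsContDiff 1 (u t) := (hu.isSmooth_slice ht).isContDiff (by simp)
  -- continuity of the sources
  have hcF : ∀ (Lst : List (DiffMonomial (Fin 3) PIdx)), (∀ T ∈ Lst, ContDiffOn ℝ ∞ (uncurry T.coeff) quadrant) →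
      Continuous fun y => (Lst.map fun T => T.eval (primFields ρ u ϑ t) PIdx.rho PIdx.theta y).sum :=
    fun Lst hL => (isSmooth_list_sum _ fun T hT => isSmooth_eval hφs (hL T hT) hφq).continuous
  -- pointwise bounds at time `t`
  have bK := hKb t ht
  have bM := hMb t ht
  have bdiv : ∀ y, |∑ k, partialDeriv k (fun y => u t y k) y| ≤ 3 * Λ := fun y => by
    calc |∑ k, partialDeriv k (fun y => u t y k) y| ≤ ∑ k, |partialDeriv k (fun y => u t y k) y| :=
          Finset.abs_sum_le_sum_abs _ _
      _ ≤ ∑ _k : Fin 3, Λ := Finset.sum_le_sum fun k _ => by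
          rw [partialDeriv_apply_coord hu1]
          exact (abs_apply_le_norm _ _).trans ((bM y).2 k).2.1
      _ = 3 * Λ := by simp
  have btrans : ∀ (g : 𝕋³ → ℝ), (∀ i y, |partialDeriv i g y| ≤ Λ) →
      ∀ y, |∑ i, u t y i * partialDeriv i g y| ≤ 3 * Λ ^ 2 := fun g hg y => by
    calc |∑ i, u t y i * partialDeriv i g y| ≤ ∑ i, |u t y i * partialDeriv i g y| :=
          Finset.abs_sum_le_sum_abs _ _
      _ ≤ ∑ _i : Fin 3, Λ * Λ := Finset.sum_le_sum fun i _ => by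
          rw [abs_mul]
          exact mul_le_mul ((abs_apply_le_norm _ _).trans (bM y).1) (hg i y) (abs_nonneg _) hΛ0
      _ = 3 * Λ ^ 2 := by simp; ring
  -- `∂ₜρ` and `∂ₜϑ`
  have bρt : ∀ y, |timeDerivWithin (Icc a b) ρ t y| ≤ 6 * Λ ^ 2 := fun y => by
    have e := h.continuity t ht y
    simp only [Torus.divergence] at e
    have e' : timeDerivWithin (Icc a b) ρ t y = -(∑ i, u t y i * partialDeriv i (ρ t) y) -
        ρ t y * ∑ k, partialDeriv k (fun y => u t y k) y := by linarith
    rw [e']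
    calc |-(∑ i, u t y i * partialDeriv i (ρ t) y) - ρ t y * ∑ k, partialDeriv k (fun y => u t y k) y|
        ≤ |∑ i, u t y i * partialDeriv i (ρ t) y| + |ρ t y| * |∑ k, partialDeriv k (fun y => u t y k) y| := by
          rw [← abs_neg (∑ i, u t y i * partialDeriv i (ρ t) y), ← abs_mul]; exact abs_sub _ _
      _ ≤ 3 * Λ ^ 2 + Λ * (3 * Λ) := add_le_add (btrans _ (fun i y => ((bM y).2 i).1) y)
          (mul_le_mul (bK y).1 (bdiv y) (abs_nonneg _) hΛ0)
      _ = 6 * Λ ^ 2 := by ring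
  have bϑt : ∀ y, |timeDerivWithin (Icc a b) ϑ t y| ≤ 6 * Λ ^ 2 := fun y => by
    have e := h.temperature_eq hS ht y
    simp only [Torus.divergence] at e
    have e' : timeDerivWithin (Icc a b) ϑ t y = -(∑ i, u t y i * partialDeriv i (ϑ t) y) -
        Dcoef ζ (ρ t y) (ϑ t y) * ∑ k, partialDeriv k (fun y => u t y k) y := by
      simp only [Dcoef]; linarith
    rw [e']
    calc |-(∑ i, u t y i * partialDeriv i (ϑ t) y) - Dcoef ζ (ρ t y) (ϑ t y) * ∑ k, partialDeriv k (fun y => u t y k) y|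
        ≤ |∑ i, u t y i * partialDeriv i (ϑ t) y| +
          |Dcoef ζ (ρ t y) (ϑ t y)| * |∑ k, partialDeriv k (fun y => u t y k) y| := by
          rw [← abs_neg (∑ i, u t y i * partialDeriv i (ϑ t) y), ← abs_mul]; exact abs_sub _ _
      _ ≤ 3 * Λ ^ 2 + Λ * (3 * Λ) := add_le_add (btrans _ (fun i y => ((bM y).2 i).2.2) y)
          (mul_le_mul (bK y).2.2.2.2.2.2.2.2.2.2 (bdiv y) (abs_nonneg _) hΛ0)
      _ = 6 * Λ ^ 2 := by ring
  -- time derivatives of the composite weights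
  have bcomp_t : ∀ {g : ℝ → ℝ → ℝ}, ContDiffOn ℝ ∞ (uncurry g) quadrant →
      (∀ y, |dR g (ρ t y) (ϑ t y)| ≤ Λ) → (∀ y, |dT g (ρ t y) (ϑ t y)| ≤ Λ) →
      ∀ y, |timeDerivWithin (Icc a b) (fun s y => g (ρ s y) (ϑ s y)) t y| ≤ L := by
    intro g hg hgR hgT y
    rw [timeDerivWithin_comp₂ hg isOpen_quadrant (by simp) hρ hϑ hS ht y (hφq y)]
    change |dR g (ρ t y) (ϑ t y) * timeDerivWithin (Icc a b) ρ t y +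
      dT g (ρ t y) (ϑ t y) * timeDerivWithin (Icc a b) ϑ t y| ≤ L
    calc _ ≤ |dR g (ρ t y) (ϑ t y)| * |timeDerivWithin (Icc a b) ρ t y| +
          |dT g (ρ t y) (ϑ t y)| * |timeDerivWithin (Icc a b) ϑ t y| := by
          rw [← abs_mul, ← abs_mul]; exact abs_add_le _ _
      _ ≤ Λ * (6 * Λ ^ 2) + Λ * (6 * Λ ^ 2) := add_le_add (mul_le_mul (hgR y) (bρt y) (abs_nonneg _) hΛ0)
          (mul_le_mul (hgT y) (bϑt y) (abs_nonneg _) hΛ0)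
      _ = L := by rw [hL]; ring
  -- space derivatives of the composite weights
  have bcomp_x : ∀ {g : ℝ → ℝ → ℝ}, ContDiffOn ℝ ∞ (uncurry g) quadrant →
      (∀ y, |dR g (ρ t y) (ϑ t y)| ≤ Λ) → (∀ y, |dT g (ρ t y) (ϑ t y)| ≤ Λ) →
      ∀ i y, |partialDeriv i (fun y => g (ρ t y) (ϑ t y)) y| ≤ L := by
    intro g hg hgR hgT i y
    rw [partialDeriv_comp₂ hg isOpen_quadrant (by simp) hρ1 hϑ1 y (hφq y) i]
    change |dR g (ρ t y) (ϑ t y) * partialDeriv i (ρ t) y + dT g (ρ t y) (ϑ t y) * partialDeriv i (ϑ t) y| ≤ L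
    calc _ ≤ |dR g (ρ t y) (ϑ t y)| * |partialDeriv i (ρ t) y| + |dT g (ρ t y) (ϑ t y)| * |partialDeriv i (ϑ t) y| := by
          rw [← abs_mul, ← abs_mul]; exact abs_add_le _ _
      _ ≤ Λ * Λ + Λ * Λ := add_le_add (mul_le_mul (hgR y) ((bM y).2 i).1 (abs_nonneg _) hΛ0)
          (mul_le_mul (hgT y) ((bM y).2 i).2.2 (abs_nonneg _) hΛ0)
      _ ≤ L := by nlinarith [hΛ2L]
  have hdRZ : ∀ y, |dR (Zcoef ζ) (ρ t y) (ϑ t y)| ≤ Λ := fun y => by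
    simp only [dR, Zcoef]; exact (bK y).2.2.2.2.2.2.2.2.2.1
  have hdTZ : ∀ y, |dT (Zcoef ζ) (ρ t y) (ϑ t y)| ≤ Λ := fun y => by
    simp only [dT, Zcoef, deriv_const, abs_zero]; exact hΛ0
  -- the symmetriser relation
  have hPZ : ∀ y, ρ t y * Zcoef ζ (ρ t y) (ϑ t y) = Ccoef (ρ t y) (ϑ t y) * Dcoef ζ (ρ t y) (ϑ t y) := by
    intro y
    have hθ : ϑ t y ≠ 0 := (h.temperature_pos t ht y).ne'
    simp only [Zcoef, Ccoef, Dcoef]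
    field_simp
  -- apply the abstract inequality
  have key := abs_integral_timeDerivWithin_energy_le hS ht (A := fun s y => Acoef ζ (ρ s y) (ϑ s y))
    (P := ρ) (C := fun s y => Ccoef (ρ s y) (ϑ s y)) (Z := fun s y => Zcoef ζ (ρ s y) (ϑ s y))
    (D := fun s y => Dcoef ζ (ρ s y) (ϑ s y)) (R := fun s => iterPartialDeriv w (ρ s))
    (Θ := fun s => iterPartialDeriv w (ϑ s)) (U := fun k s => iterPartialDeriv w fun y => u s y k)
    (uu := fun i s y => u s y i) hA hρ hC hZ hR hΘ hU huu
    (F := fun y => ((FF w).map fun T => T.eval (primFields ρ u ϑ t) PIdx.rho PIdx.theta y).sum)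
    (G := fun k y => ((GG ζ k w).map fun T => T.eval (primFields ρ u ϑ t) PIdx.rho PIdx.theta y).sum)
    (H := fun y => ((HH ζ w).map fun T => T.eval (primFields ρ u ϑ t) PIdx.rho PIdx.theta y).sum)
    (hcF _ fun T hT => (mem_FF w hT).2.2.2.2.2) (fun k => hcF _ fun T hT => (mem_GG hζ k w hT).2.2.2.2.2)
    (hcF _ fun T hT => (mem_HH hζ w hT).2.2.2.2.2)
    (fun y => continuity_word hab h w ht y)
    (fun k y => by simpa only [Zcoef] using momentum_word hζ hab h k w ht y)
    (fun y => temperature_word hζ hab h w ht y) hPZ hL0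
    (fun y => ((bK y).2.2.1).trans hΛL) (fun y => ((bK y).1).trans hΛL)
    (fun y => ((bK y).2.2.2.2.2.1).trans hΛL)
    (fun y => by simpa only [Zcoef] using ((bK y).2.2.2.2.2.2.2.2.1).trans hΛL)
    (fun i y => ((abs_apply_le_norm _ _).trans (bM y).1).trans hΛL)
    (bcomp_t (contDiffOn_Acoef hζ) (fun y => (bK y).2.2.2.1) (fun y => (bK y).2.2.2.2.1))
    (fun y => (bρt y).trans hΛ6L)
    (bcomp_t contDiffOn_Ccoef (fun y => (bK y).2.2.2.2.2.2.1) (fun y => (bK y).2.2.2.2.2.2.2.1))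
    (bcomp_x (contDiffOn_Acoef hζ) (fun y => (bK y).2.2.2.1) (fun y => (bK y).2.2.2.2.1))
    (fun i y => (((bM y).2 i).1).trans hΛL)
    (bcomp_x contDiffOn_Ccoef (fun y => (bK y).2.2.2.2.2.2.1) (fun y => (bK y).2.2.2.2.2.2.2.1))
    (bcomp_x (contDiffOn_Zcoef hζ) hdRZ hdTZ)
    (fun i j y => by
      rw [partialDeriv_apply_coord hu1]
      exact ((abs_apply_le_norm _ _).trans ((bM y).2 i).2.1).trans hΛL)
  simpa only [wordEnergy] using key

/-! ### `L²` bounds for lists of commutator monomials -/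

/-- `∫ g² ≤ B²` on the (probability) torus when `|g| ≤ B`. [folklore] -/
theorem integral_sq_le_sq_of_abs_le {g : 𝕋³ → ℝ} (hg : Continuous g) {B : ℝ} (hB : ∀ x, |g x| ≤ B) :
    ∫ x, g x ^ 2 ≤ B ^ 2 := by
  have hB0 : 0 ≤ B := (abs_nonneg _).trans (hB 0)
  calc ∫ x, g x ^ 2 ≤ ∫ _ : 𝕋³, B ^ 2 := integral_mono (hg.pow 2).integrable_unitAddTorus (integrable_const _)
        fun x => by
          show g x ^ 2 ≤ B ^ 2
          calc g x ^ 2 = |g x| ^ 2 := (sq_abs _).symm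
            _ ≤ B ^ 2 := pow_le_pow_left₀ (abs_nonneg _) (hB x) 2
    _ = B ^ 2 := by simp

/-- `√(∫ g²) ≤ B` when `|g| ≤ B`, `B ≥ 0`. [folklore] -/
theorem sqrt_integral_sq_le_of_abs_le {g : 𝕋³ → ℝ} (hg : Continuous g) {B : ℝ} (hB0 : 0 ≤ B)
    (hB : ∀ x, |g x| ≤ B) : Real.sqrt (∫ x, g x ^ 2) ≤ B := by
  rw [Real.sqrt_le_left hB0]; exact integral_sq_le_sq_of_abs_le hg hB

/-- **`L²` bound for a list of commutator monomials at level `m`.** For a list of monomials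
with coefficients smooth on the quadrant there is `Γ ≥ 0` (the sum of sup bounds of the
coefficients on the compact state set `K`) such that, whenever all monomials have the shape of
a level-`n` commutator (`n ≤ m`) and the fields obey the level-`m` bounds (`S` in sup up to order
`max 1 (m-3)`, `Ξ` in sup up to order `m - 2`, `B` in `L²` up to order `m - 1`, `X` in `L²` up to
order `m`), the `L²` norm of the sum is at most `Γ S^{m+1} (3X + BΞ + 1)`.
[cite: Majda1984, Ch. 2 §2.1 Thm 2.2] -/
theorem exists_list_l2_bound {K : Set (ℝ × ℝ)} (hK : IsCompact K) (hKq : K ⊆ quadrant) :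
    ∀ (Lst : List (DiffMonomial (Fin 3) PIdx)),
      (∀ T ∈ Lst, ContDiffOn ℝ ∞ (uncurry T.coeff) quadrant) →
      ∃ Γ : ℝ, 0 ≤ Γ ∧ ∀ (φ : PIdx → 𝕋³ → ℝ), (∀ k, IsSmooth (φ k)) →
        (∀ x, (φ PIdx.rho x, φ PIdx.theta x) ∈ K) →
        ∀ (n m : ℕ), (∀ T ∈ Lst, T.Proper ∧ 2 ≤ T.width ∧ T.width ≤ n + 1 ∧ T.order = n + 1 ∧
          T.maxOrder ≤ n) → n ≤ m →
        ∀ (S Ξ B X : ℝ), 1 ≤ S → 0 ≤ Ξ → 0 ≤ B → 0 ≤ X →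
          (∀ (k : PIdx) (v : List (Fin 3)), v.length ≤ max 1 (m - 3) → ∀ x, |iterPartialDeriv v (φ k) x| ≤ S) →
          (∀ (k : PIdx) (v : List (Fin 3)), v.length ≤ m - 2 → ∀ x, |iterPartialDeriv v (φ k) x| ≤ Ξ) →
          (∀ (k : PIdx) (v : List (Fin 3)), v.length ≤ m - 1 →
            Real.sqrt (∫ x, iterPartialDeriv v (φ k) x ^ 2) ≤ B) →
          (∀ (k : PIdx) (v : List (Fin 3)), v.length ≤ m →
            Real.sqrt (∫ x, iterPartialDeriv v (φ k) x ^ 2) ≤ X) →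
          Real.sqrt (∫ x, ((Lst.map fun T => T.eval φ PIdx.rho PIdx.theta x).sum) ^ 2) ≤
            Γ * S ^ (m + 1) * (3 * X + B * Ξ + 1)
  | [], _ => ⟨0, le_rfl, fun φ _ _ n m _ _ S Ξ B X _ _ _ _ _ _ _ _ => by simp⟩
  | T :: Lst, hcoef => by
    obtain ⟨Γ', hΓ'0, hΓ'⟩ := exists_list_l2_bound hK hKq Lst fun T' hT' => hcoef T' (List.mem_cons_of_mem _ hT')
    have hTc : ContDiffOn ℝ ∞ (uncurry T.coeff) quadrant := hcoef T List.mem_cons_self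
    obtain ⟨G, hG1, hG⟩ := exists_abs_le_of_continuousOn hK (hTc.continuousOn.mono hKq)
    have hG0 : 0 ≤ G := zero_le_one.trans hG1
    refine ⟨G + Γ', by positivity, fun φ hφ hφK n m hshape hnm S Ξ B X hS1 hΞ0 hB0 hX0 hS hΞ hB hX => ?_⟩
    have hS0 : 0 ≤ S := zero_le_one.trans hS1
    have hφq : ∀ x, (φ PIdx.rho x, φ PIdx.theta x) ∈ quadrant := fun x => hKq (hφK x)
    obtain ⟨hTp, hTw2, hTwn, hTo, hTmax⟩ := hshape T List.mem_cons_self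
    have hGx : ∀ x, |T.coeff (φ PIdx.rho x) (φ PIdx.theta x)| ≤ G := fun x => hG _ (hφK x)
    have hrest := hΓ' φ hφ hφK n m (fun T' hT' => hshape T' (List.mem_cons_of_mem _ hT')) hnm S Ξ B X hS1 hΞ0
      hB0 hX0 hS hΞ hB hX
    have hQ1 : 1 ≤ 3 * X + B * Ξ + 1 := by nlinarith [mul_nonneg hB0 hΞ0]
    have hQ0 : 0 ≤ 3 * X + B * Ξ + 1 := zero_le_one.trans hQ1
    have hSpow : S ^ T.width ≤ S ^ (m + 1) := pow_le_pow_right₀ hS1 (by omega)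
    -- the bound for the head monomial
    have hhead : Real.sqrt (∫ x, T.eval φ PIdx.rho PIdx.theta x ^ 2) ≤ G * S ^ (m + 1) * (3 * X + B * Ξ + 1) := by
      by_cases hn : 2 ≤ n
      · have h1 := sqrt_integral_eval_sq_le hφ hTp hTw2 hn hTo hTmax hG0 hGx hS1
          (fun k v hv x => hS k v (hv.trans (max_le_max le_rfl (by omega))) x) hΞ0
          (fun k v hv x => hΞ k v (by omega) x) hB0 (fun k v hv => hB k v (by omega)) hX0
          (fun k v hv => hX k v (by omega))
        calc _ ≤ G * S ^ T.width * (3 * X + B * Ξ) := h1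
          _ ≤ G * S ^ (m + 1) * (3 * X + B * Ξ + 1) :=
              mul_le_mul (mul_le_mul_of_nonneg_left hSpow hG0) (by linarith) (by nlinarith [mul_nonneg hB0 hΞ0])
                (by positivity)
      · -- `n ≤ 1`: all factors have order `≤ 1`, pointwise bound
        push Not at hn
        have hfac : ∀ f ∈ T.factors, ∀ x, |iterPartialDeriv f.1 (φ f.2) x| ≤ S := fun f hf x =>
          hS f.2 f.1 ((length_le_maxOrder hf).trans (hTmax.trans (by omega))) x
        have hpt : ∀ x, |T.eval φ PIdx.rho PIdx.theta x| ≤ G * S ^ T.width := fun x => by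
          rw [eval_def, abs_mul]
          exact mul_le_mul (hGx x) (abs_prodEval_le_pow hS0 _ hfac x) (abs_nonneg _) hG0
        have hcont : Continuous (T.eval φ PIdx.rho PIdx.theta) := (isSmooth_eval hφ hTc hφq).continuous
        calc _ ≤ G * S ^ T.width := sqrt_integral_sq_le_of_abs_le hcont (by positivity) hpt
          _ ≤ G * S ^ (m + 1) * 1 := by rw [mul_one]; exact mul_le_mul_of_nonneg_left hSpow hG0
          _ ≤ G * S ^ (m + 1) * (3 * X + B * Ξ + 1) := mul_le_mul_of_nonneg_left hQ1 (by positivity)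
    -- triangle inequality
    have hcT : Continuous (T.eval φ PIdx.rho PIdx.theta) := (isSmooth_eval hφ hTc hφq).continuous
    have hcL : Continuous fun x => (Lst.map fun T => T.eval φ PIdx.rho PIdx.theta x).sum :=
      (isSmooth_list_sum _ fun T' hT' => isSmooth_eval hφ (hcoef T' (List.mem_cons_of_mem _ hT')) hφq).continuous
    simp only [List.map_cons, List.sum_cons]
    calc Real.sqrt (∫ x, (T.eval φ PIdx.rho PIdx.theta x + (Lst.map fun T => T.eval φ PIdx.rho PIdx.theta x).sum) ^ 2)
        ≤ Real.sqrt (∫ x, T.eval φ PIdx.rho PIdx.theta x ^ 2) +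
          Real.sqrt (∫ x, ((Lst.map fun T => T.eval φ PIdx.rho PIdx.theta x).sum) ^ 2) :=
          sqrt_integral_add_sq_le hcT hcL
      _ ≤ G * S ^ (m + 1) * (3 * X + B * Ξ + 1) + Γ' * S ^ (m + 1) * (3 * X + B * Ξ + 1) := add_le_add hhead hrest
      _ = (G + Γ') * S ^ (m + 1) * (3 * X + B * Ξ + 1) := by ring

/-! ### Low-order pointwise bounds packaged -/

/-- Components commute with iterated partial derivatives of smooth vector fields. [folklore] -/
theorem iterPartialDeriv_apply_coord {v : 𝕋³ → ℝ³} (hv : IsSmooth v) :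
    ∀ (l : List (Fin 3)) (x : 𝕋³) (k : Fin 3), iterPartialDeriv l (fun y => v y k) x = iterPartialDeriv l v x k
  | [], x, k => rfl
  | i :: l, x, k => by
    simp only [iterPartialDeriv_cons]
    have hfun : iterPartialDeriv l (fun y => v y k) = fun y => iterPartialDeriv l v y k :=
      funext fun y => iterPartialDeriv_apply_coord hv l y k
    rw [hfun, partialDeriv_apply_coord ((hv.iterPartialDeriv l).isContDiff (by simp))]

/-- The Euclidean norm on `ℝ³` is at most the sum of the absolute values of the components.
[folklore] -/
theorem norm_le_sum_abs (v : ℝ³) : ‖v‖ ≤ ∑ i, |v i| := by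
  rw [EuclideanSpace.norm_eq]
  rw [Real.sqrt_le_left (Finset.sum_nonneg fun i _ => abs_nonneg _)]
  simp only [Real.norm_eq_abs, Fin.sum_univ_three]
  nlinarith [abs_nonneg (v 0), abs_nonneg (v 1), abs_nonneg (v 2), sq_abs (v 0), sq_abs (v 1), sq_abs (v 2)]

/-! ### The Grönwall step -/

/-- `√E ≤ E + 1`. [folklore] -/
theorem sqrt_le_add_one {E : ℝ} (hE : 0 ≤ E) : Real.sqrt E ≤ E + 1 := by
  nlinarith [Real.sq_sqrt hE, Real.sqrt_nonneg E, sq_nonneg (Real.sqrt E - 1)]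

/-- Words of length `≤ 1` are `[]` or singletons. [folklore] -/
theorem list_length_le_one {α : Type*} {v : List α} (hv : v.length ≤ 1) : v = [] ∨ ∃ i, v = [i] := by
  rcases v with _ | ⟨i, _ | ⟨j, v⟩⟩
  · exact Or.inl rfl
  · exact Or.inr ⟨i, rfl⟩
  · simp at hv

/-- **The induction step of the `H^m` estimate** (Majda 1984, proof of Thm 2.2): if the
level-`(m-1)` energy of a primitive solution on `[0, T)` with state in the compact set `K` of
the hyperbolicity region and `C¹` bound `M` is bounded on `[0, T)`, then so is the level-`m`
energy (`m ≥ 2`). [cite: Majda1984, Ch. 2 §2.1 Thm 2.2 (2.38)] -/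
theorem levelEnergy_step (hζ : ContDiff ℝ ∞ ζ) {T : ℝ} (hT : 0 < T)
    (h : IsPrimitiveEulerSolutionOn (EulerEOS.monatomicExcess ζ f) (Ico 0 T) ρ u ϑ)
    {K : Set (ℝ × ℝ)} (hK : IsCompact K)
    (hKhyp : K ⊆ {z : ℝ × ℝ | 0 < z.1 ∧ 0 < z.2 ∧ 0 < deriv (fun s => s * ζ s) z.1})
    (hstate : ∀ t ∈ Ico 0 T, ∀ x, (ρ t x, ϑ t x) ∈ K)
    {M : ℝ} (hC1 : ∀ t ∈ Ico 0 T, ∀ x, ‖u t x‖ ≤ M ∧ ∀ i, |partialDeriv i (ρ t) x| ≤ M ∧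
      ‖partialDeriv i (u t) x‖ ≤ M ∧ |partialDeriv i (ϑ t) x| ≤ M)
    {m : ℕ} (hm : 2 ≤ m) {Cprev : ℝ} (hprev : ∀ t ∈ Ico 0 T, levelEnergy ρ u ϑ (m - 1) t ≤ Cprev) :
    ∃ C : ℝ, ∀ t ∈ Ico 0 T, levelEnergy ρ u ϑ m t ≤ C := by
  have hKq : K ⊆ quadrant := fun z hz => ⟨(hKhyp hz).1, (hKhyp hz).2.1⟩
  -- (1) the weights
  obtain ⟨c₀, c₁, hc₀, hc₀₁, hwK⟩ := exists_weights_bounds hζ hK hKhyp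
  have hc₁ : 0 < c₁ := hc₀.trans_le hc₀₁
  -- (2) Sobolev
  obtain ⟨KS, hKS, hSob⟩ := exists_sobolev_const
  -- (3) the static bound `Λ`
  have hζ' : ContDiff ℝ ∞ (deriv ζ) := (contDiff_infty_iff_deriv.1 hζ).2
  have cA : ContinuousOn (uncurry (Acoef ζ)) K := (contDiffOn_Acoef hζ).continuousOn.mono hKq
  have cAR : ContinuousOn (uncurry (dR (Acoef ζ))) K :=
    (contDiffOn_dR (contDiffOn_Acoef hζ) isOpen_quadrant).continuousOn.mono hKq
  have cAT : ContinuousOn (uncurry (dT (Acoef ζ))) K :=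
    (contDiffOn_dT (contDiffOn_Acoef hζ) isOpen_quadrant).continuousOn.mono hKq
  have cC : ContinuousOn (uncurry Ccoef) K := contDiffOn_Ccoef.continuousOn.mono hKq
  have cCR : ContinuousOn (uncurry (dR Ccoef)) K :=
    (contDiffOn_dR contDiffOn_Ccoef isOpen_quadrant).continuousOn.mono hKq
  have cCT : ContinuousOn (uncurry (dT Ccoef)) K :=
    (contDiffOn_dT contDiffOn_Ccoef isOpen_quadrant).continuousOn.mono hKq
  have cZ : ContinuousOn (fun z : ℝ × ℝ => ζ z.1) K := (hζ.continuous.comp continuous_fst).continuousOn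
  have cZ' : ContinuousOn (fun z : ℝ × ℝ => deriv ζ z.1) K := (hζ'.continuous.comp continuous_fst).continuousOn
  have cD : ContinuousOn (uncurry (Dcoef ζ)) K := (contDiffOn_Dcoef hζ).continuousOn.mono hKq
  obtain ⟨B1, hB1, b1⟩ := exists_abs_le_of_continuousOn hK continuous_fst.continuousOn
  obtain ⟨B2, hB2, b2⟩ := exists_abs_le_of_continuousOn hK continuous_snd.continuousOn
  obtain ⟨B3, hB3, b3⟩ := exists_abs_le_of_continuousOn hK cA
  obtain ⟨B4, hB4, b4⟩ := exists_abs_le_of_continuousOn hK cAR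
  obtain ⟨B5, hB5, b5⟩ := exists_abs_le_of_continuousOn hK cAT
  obtain ⟨B6, hB6, b6⟩ := exists_abs_le_of_continuousOn hK cC
  obtain ⟨B7, hB7, b7⟩ := exists_abs_le_of_continuousOn hK cCR
  obtain ⟨B8, hB8, b8⟩ := exists_abs_le_of_continuousOn hK cCT
  obtain ⟨B9, hB9, b9⟩ := exists_abs_le_of_continuousOn hK cZ
  obtain ⟨B10, hB10, b10⟩ := exists_abs_le_of_continuousOn hK cZ'
  obtain ⟨B11, hB11, b11⟩ := exists_abs_le_of_continuousOn hK cD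
  obtain ⟨Λ, hΛdef⟩ : ∃ Λ : ℝ, Λ = B1 + B2 + B3 + B4 + B5 + B6 + B7 + B8 + B9 + B10 + B11 + |M| := ⟨_, rfl⟩
  have hMΛ : M ≤ Λ := by have := le_abs_self M; rw [hΛdef]; linarith
  have hΛ1 : 1 ≤ Λ := by rw [hΛdef]; linarith [abs_nonneg M]
  have hΛ0 : 0 ≤ Λ := zero_le_one.trans hΛ1
  have hKb : ∀ t ∈ Ico 0 T, ∀ y, |ρ t y| ≤ Λ ∧ |ϑ t y| ≤ Λ ∧ |Acoef ζ (ρ t y) (ϑ t y)| ≤ Λ ∧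
      |dR (Acoef ζ) (ρ t y) (ϑ t y)| ≤ Λ ∧ |dT (Acoef ζ) (ρ t y) (ϑ t y)| ≤ Λ ∧
      |Ccoef (ρ t y) (ϑ t y)| ≤ Λ ∧ |dR Ccoef (ρ t y) (ϑ t y)| ≤ Λ ∧ |dT Ccoef (ρ t y) (ϑ t y)| ≤ Λ ∧
      |ζ (ρ t y)| ≤ Λ ∧ |deriv ζ (ρ t y)| ≤ Λ ∧ |Dcoef ζ (ρ t y) (ϑ t y)| ≤ Λ := by
    intro t ht y
    have hz := hstate t ht y
    have l1 := b1 _ hz; have l2 := b2 _ hz; have l3 := b3 _ hz; have l4 := b4 _ hz; have l5 := b5 _ hz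
    have l6 := b6 _ hz; have l7 := b7 _ hz; have l8 := b8 _ hz; have l9 := b9 _ hz; have l10 := b10 _ hz
    have l11 := b11 _ hz
    simp only [uncurry] at l1 l2 l3 l4 l5 l6 l7 l8 l9 l10 l11
    have hpos : ∀ {x B : ℝ}, |x| ≤ B → B ≤ Λ → |x| ≤ Λ := fun h1 h2 => h1.trans h2
    have hall : 0 ≤ B1 ∧ 0 ≤ B2 ∧ 0 ≤ B3 ∧ 0 ≤ B4 ∧ 0 ≤ B5 ∧ 0 ≤ B6 ∧ 0 ≤ B7 ∧ 0 ≤ B8 ∧ 0 ≤ B9 ∧ 0 ≤ B10 ∧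
        0 ≤ B11 ∧ 0 ≤ |M| := ⟨by linarith, by linarith, by linarith, by linarith, by linarith, by linarith,
          by linarith, by linarith, by linarith, by linarith, by linarith, abs_nonneg M⟩
    refine ⟨hpos l1 ?_, hpos l2 ?_, hpos l3 ?_, hpos l4 ?_, hpos l5 ?_, hpos l6 ?_, hpos l7 ?_, hpos l8 ?_,
      hpos l9 ?_, hpos l10 ?_, hpos l11 ?_⟩ <;> (rw [hΛdef]; linarith)
  have hMb : ∀ t ∈ Ico 0 T, ∀ y, ‖u t y‖ ≤ Λ ∧ ∀ i, |partialDeriv i (ρ t) y| ≤ Λ ∧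
      ‖partialDeriv i (u t) y‖ ≤ Λ ∧ |partialDeriv i (ϑ t) y| ≤ Λ := fun t ht y =>
    ⟨(hC1 t ht y).1.trans hMΛ, fun i => ⟨((hC1 t ht y).2 i).1.trans hMΛ, ((hC1 t ht y).2 i).2.1.trans hMΛ,
      ((hC1 t ht y).2 i).2.2.trans hMΛ⟩⟩
  obtain ⟨L, hLdef⟩ : ∃ L : ℝ, L = 12 * Λ ^ 3 := ⟨_, rfl⟩
  have hL0 : 0 ≤ L := by rw [hLdef]; exact mul_nonneg (by norm_num) (pow_nonneg hΛ0 3)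
  -- (4) sup bounds of low order: `S`
  have hCprev0 : 0 ≤ Cprev := (levelEnergy_nonneg (ρ := ρ) (u := u) (ϑ := ϑ) (m - 1) 0).trans
    (hprev 0 ⟨le_rfl, hT⟩)
  obtain ⟨S, hSdef⟩ : ∃ S : ℝ, S = Λ + Real.sqrt (KS * Cprev) := ⟨_, rfl⟩
  have hS1 : 1 ≤ S := by rw [hSdef]; linarith [Real.sqrt_nonneg (KS * Cprev)]
  have hS0 : 0 ≤ S := zero_le_one.trans hS1
  have hφs : ∀ t ∈ Ico 0 T, ∀ k, IsSmooth (primFields ρ u ϑ t k) := fun t ht => isSmooth_primFields h ht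
  have hlow : ∀ t ∈ Ico 0 T, ∀ (k : PIdx) (v : List (Fin 3)), v.length ≤ 1 → ∀ x,
      |iterPartialDeriv v (primFields ρ u ϑ t k) x| ≤ Λ := by
    intro t ht k v hv x
    have hu1 : IsContDiff 1 (u t) := (h.smooth_velocity.isSmooth_slice ht).isContDiff (by simp)
    rcases list_length_le_one hv with rfl | ⟨i, rfl⟩
    · rcases k with _ | _ | k
      · exact (hKb t ht x).1
      · exact (hKb t ht x).2.1
      · simp only [iterPartialDeriv_nil, primFields]
        exact (abs_apply_le_norm _ _).trans (hMb t ht x).1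
    · rcases k with _ | _ | k
      · simpa using ((hMb t ht x).2 i).1
      · simpa using ((hMb t ht x).2 i).2.2
      · simp only [iterPartialDeriv_cons, iterPartialDeriv_nil, primFields]
        rw [partialDeriv_apply_coord hu1]
        exact (abs_apply_le_norm _ _).trans ((hMb t ht x).2 i).2.1
  have hSup : ∀ t ∈ Ico 0 T, ∀ (k : PIdx) (v : List (Fin 3)), v.length ≤ max 1 (m - 3) → ∀ x,
      |iterPartialDeriv v (primFields ρ u ϑ t k) x| ≤ S := by
    intro t ht k v hv x
    by_cases h1 : v.length ≤ 1
    · exact (hlow t ht k v h1 x).trans (by rw [hSdef]; linarith [Real.sqrt_nonneg (KS * Cprev)])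
    · have hv' : v.length + 2 ≤ m - 1 := by
        have := le_max_iff.1 hv; omega
      have h2 := hSob ρ ϑ u t (hφs t ht) k v x
      have h3 : levelEnergy ρ u ϑ (v.length + 2) t ≤ Cprev := (levelEnergy_mono hv' t).trans (hprev t ht)
      have h4 : iterPartialDeriv v (primFields ρ u ϑ t k) x ^ 2 ≤ KS * Cprev :=
        h2.trans (mul_le_mul_of_nonneg_left h3 hKS.le)
      calc |iterPartialDeriv v (primFields ρ u ϑ t k) x| = Real.sqrt (iterPartialDeriv v (primFields ρ u ϑ t k) x ^ 2) :=
            (Real.sqrt_sq_eq_abs _).symm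
        _ ≤ Real.sqrt (KS * Cprev) := Real.sqrt_le_sqrt h4
        _ ≤ S := by rw [hSdef]; linarith
  -- (5) the coefficient constants `Γ`, uniformly over all words of length `≤ m`
  have hΓall : ∀ σ : (Σ n : Fin (m + 1), (Fin n → Fin 3)),
      ∃ Γ : ℝ, 0 ≤ Γ ∧ ∀ (φ : PIdx → 𝕋³ → ℝ), (∀ k, IsSmooth (φ k)) →
        (∀ x, (φ PIdx.rho x, φ PIdx.theta x) ∈ K) →
        ∀ (S Ξ B X : ℝ), 1 ≤ S → 0 ≤ Ξ → 0 ≤ B → 0 ≤ X →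
          (∀ (k : PIdx) (v : List (Fin 3)), v.length ≤ max 1 (m - 3) → ∀ x, |iterPartialDeriv v (φ k) x| ≤ S) →
          (∀ (k : PIdx) (v : List (Fin 3)), v.length ≤ m - 2 → ∀ x, |iterPartialDeriv v (φ k) x| ≤ Ξ) →
          (∀ (k : PIdx) (v : List (Fin 3)), v.length ≤ m - 1 →
            Real.sqrt (∫ x, iterPartialDeriv v (φ k) x ^ 2) ≤ B) →
          (∀ (k : PIdx) (v : List (Fin 3)), v.length ≤ m →
            Real.sqrt (∫ x, iterPartialDeriv v (φ k) x ^ 2) ≤ X) →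
          Real.sqrt (∫ x, (((FF (List.ofFn σ.2)).map fun T => T.eval φ PIdx.rho PIdx.theta x).sum) ^ 2) ≤
              Γ * S ^ (m + 1) * (3 * X + B * Ξ + 1) ∧
            (∀ k, Real.sqrt (∫ x, (((GG ζ k (List.ofFn σ.2)).map fun T => T.eval φ PIdx.rho PIdx.theta x).sum) ^ 2) ≤
              Γ * S ^ (m + 1) * (3 * X + B * Ξ + 1)) ∧
            Real.sqrt (∫ x, (((HH ζ (List.ofFn σ.2)).map fun T => T.eval φ PIdx.rho PIdx.theta x).sum) ^ 2) ≤
              Γ * S ^ (m + 1) * (3 * X + B * Ξ + 1) := by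
    rintro ⟨n, w⟩
    have hn : (List.ofFn w).length ≤ m := by simp; omega
    obtain ⟨Γ₁, hΓ₁0, hΓ₁⟩ := exists_list_l2_bound hK hKq (FF (List.ofFn w)) fun T hT => (mem_FF _ hT).2.2.2.2.2
    have hG : ∀ k, ∃ Γ : ℝ, 0 ≤ Γ ∧ _ := fun k =>
      exists_list_l2_bound hK hKq (GG ζ k (List.ofFn w)) fun T hT => (mem_GG hζ k _ hT).2.2.2.2.2
    choose Γ₂ hΓ₂0 hΓ₂ using hG
    obtain ⟨Γ₃, hΓ₃0, hΓ₃⟩ := exists_list_l2_bound hK hKq (HH ζ (List.ofFn w)) fun T hT => (mem_HH hζ _ hT).2.2.2.2.2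
    refine ⟨Γ₁ + (∑ k, Γ₂ k) + Γ₃, add_nonneg (add_nonneg hΓ₁0 (Finset.sum_nonneg fun k _ => hΓ₂0 k)) hΓ₃0,
      fun φ hφ hφK S Ξ B X hS1 hΞ0 hB0 hX0 hS hΞ hB hX => ?_⟩
    have shapeF : ∀ T ∈ FF (List.ofFn w), T.Proper ∧ 2 ≤ T.width ∧ T.width ≤ (List.ofFn w).length + 1 ∧
        T.order = (List.ofFn w).length + 1 ∧ T.maxOrder ≤ (List.ofFn w).length := fun T hT =>
      let h := mem_FF (List.ofFn w) hT; ⟨h.1, h.2.1, h.2.2.1, h.2.2.2.1, h.2.2.2.2.1⟩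
    have e1 := hΓ₁ φ hφ hφK _ m shapeF hn S Ξ B X hS1 hΞ0 hB0 hX0 hS hΞ hB hX
    have e3 := hΓ₃ φ hφ hφK _ m (fun T hT => let h := mem_HH hζ (List.ofFn w) hT;
      ⟨h.1, h.2.1, h.2.2.1, h.2.2.2.1, h.2.2.2.2.1⟩) hn S Ξ B X hS1 hΞ0 hB0 hX0 hS hΞ hB hX
    have e2 : ∀ k, _ := fun k => hΓ₂ k φ hφ hφK _ m (fun T hT => let h := mem_GG hζ k (List.ofFn w) hT;
      ⟨h.1, h.2.1, h.2.2.1, h.2.2.2.1, h.2.2.2.2.1⟩) hn S Ξ B X hS1 hΞ0 hB0 hX0 hS hΞ hB hX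
    have hsum2 : ∀ k, Γ₂ k ≤ ∑ k, Γ₂ k := fun k =>
      Finset.single_le_sum (f := Γ₂) (fun k _ => hΓ₂0 k) (Finset.mem_univ k)
    refine ⟨e1.trans ?_, fun k => (e2 k).trans ?_, e3.trans ?_⟩
    · have : Γ₁ ≤ Γ₁ + (∑ k, Γ₂ k) + Γ₃ := by linarith [Finset.sum_nonneg fun k (_ : k ∈ Finset.univ) => hΓ₂0 k]
      exact mul_le_mul_of_nonneg_right (mul_le_mul_of_nonneg_right this (pow_nonneg (zero_le_one.trans hS1) _))
        (by positivity)
    · have : Γ₂ k ≤ Γ₁ + (∑ k, Γ₂ k) + Γ₃ := by linarith [hsum2 k]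
      exact mul_le_mul_of_nonneg_right (mul_le_mul_of_nonneg_right this (pow_nonneg (zero_le_one.trans hS1) _))
        (by positivity)
    · have : Γ₃ ≤ Γ₁ + (∑ k, Γ₂ k) + Γ₃ := by linarith [Finset.sum_nonneg fun k (_ : k ∈ Finset.univ) => hΓ₂0 k]
      exact mul_le_mul_of_nonneg_right (mul_le_mul_of_nonneg_right this (pow_nonneg (zero_le_one.trans hS1) _))
        (by positivity)
  choose Γσ hΓσ0 hΓσ using hΓall
  let Γ : ℝ := ∑ σ, Γσ σ
  have hΓ0 : 0 ≤ Γ := Finset.sum_nonneg fun σ _ => hΓσ0 σ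
  have hΓσle : ∀ σ, Γσ σ ≤ Γ := fun σ => Finset.single_le_sum (f := Γσ) (fun σ _ => hΓσ0 σ) (Finset.mem_univ σ)
  clear_value Γ
  -- (6) the constants of the differential inequality
  have hW0 : 0 ≤ levelCount m := levelCount_nonneg m
  have hW1 : 1 ≤ levelCount m := one_le_levelCount m
  obtain ⟨Bc, hBcdef⟩ : ∃ Bc : ℝ, Bc = Real.sqrt Cprev := ⟨_, rfl⟩
  have hBc0 : 0 ≤ Bc := by rw [hBcdef]; exact Real.sqrt_nonneg _
  obtain ⟨κ, hκ⟩ : ∃ κ : ℝ, κ = 10 * L * Γ * S ^ (m + 1) := ⟨_, rfl⟩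
  have hκ0 : 0 ≤ κ := by
    rw [hκ]; exact mul_nonneg (mul_nonneg (mul_nonneg (by norm_num) hL0) hΓ0) (pow_nonneg hS0 _)
  have h4B : (0 : ℝ) ≤ 4 + Bc * Real.sqrt KS := add_nonneg (by norm_num) (mul_nonneg hBc0 (Real.sqrt_nonneg _))
  have hL18 : 0 ≤ L + 18 * L ^ 2 := add_nonneg hL0 (mul_nonneg (by norm_num) (sq_nonneg L))
  obtain ⟨K₁, hK₁⟩ : ∃ K₁ : ℝ, K₁ = (L + 18 * L ^ 2) + κ * (4 + Bc * Real.sqrt KS) := ⟨_, rfl⟩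
  have hK₁0 : 0 ≤ K₁ := by rw [hK₁]; exact add_nonneg hL18 (mul_nonneg hκ0 h4B)
  obtain ⟨Kc, hKcdef⟩ : ∃ Kc : ℝ, Kc = K₁ * (levelCount m) / c₀ + 1 := ⟨_, rfl⟩
  have hKc : 0 < Kc := by
    rw [hKcdef]; exact add_pos_of_nonneg_of_pos (div_nonneg (mul_nonneg hK₁0 hW0) hc₀.le) one_pos
  obtain ⟨εc, hεc⟩ : ∃ εc : ℝ, εc = κ * (levelCount m) := ⟨_, rfl⟩
  have hεc0 : 0 ≤ εc := by rw [hεc]; exact mul_nonneg hκ0 hW0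
  obtain ⟨δ, hδdef⟩ : ∃ δ : ℝ, δ = c₁ * levelEnergy ρ u ϑ m 0 := ⟨_, rfl⟩
  have hδ0 : 0 ≤ δ := by rw [hδdef]; exact mul_nonneg hc₁.le (levelEnergy_nonneg _ _)
  refine ⟨(δ * Real.exp (Kc * T) + εc / Kc * (Real.exp (Kc * T) - 1)) / c₀, fun t₀ ht₀ => ?_⟩
  -- (7) the sub-interval `[0, τ]`
  let τ : ℝ := max t₀ (T / 2)
  have hτ : 0 < τ := lt_max_of_lt_right (half_pos hT)
  have hτT : τ < T := max_lt ht₀.2 (half_lt_self hT)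
  have ht₀τ : t₀ ∈ Icc 0 τ := ⟨ht₀.1, le_max_left _ _⟩
  have hsub : Icc 0 τ ⊆ Ico 0 T := Icc_subset_Ico_right hτT
  have hsol := h.restrict_Icc hτ hτT
  have hSτ : UniqueDiffOn ℝ (Icc 0 τ) := uniqueDiffOn_Icc hτ
  -- the function and its derivative
  let g : ℝ → ℝ := weightedLevelEnergy ζ ρ u ϑ m
  have hgdef : g = weightedLevelEnergy ζ ρ u ϑ m := rfl
  let D : List (Fin 3) → ℝ → ℝ := fun w t => ∫ y, timeDerivWithin (Icc 0 τ)
    (fun s y => Acoef ζ (ρ s y) (ϑ s y) * iterPartialDeriv w (ρ s) y ^ 2 +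
      ρ s y * (∑ k, iterPartialDeriv w (fun y => u s y k) y ^ 2) +
      Ccoef (ρ s y) (ϑ s y) * iterPartialDeriv w (ϑ s) y ^ 2) t y
  let g' : ℝ → ℝ := fun t => ∑ n ∈ Finset.range (m + 1), ∑ w : Fin n → Fin 3, D (List.ofFn w) t
  have hderiv : ∀ t ∈ Icc 0 τ, HasDerivWithinAt g (g' t) (Icc 0 τ) t := fun t ht =>
    HasDerivWithinAt.fun_sum fun n _ => HasDerivWithinAt.fun_sum fun w _ =>
      hasDerivWithinAt_weightedWordEnergy hζ hSτ (convex_Icc 0 τ) hsol (List.ofFn w) ht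
  have hcont : ContinuousOn g (Icc 0 τ) := fun t ht => (hderiv t ht).continuousWithinAt
  have hderiv' : ∀ t ∈ Ico 0 τ, HasDerivWithinAt g (g' t) (Ici t) t := fun t ht =>
    (hderiv t (Ico_subset_Icc_self ht)).mono_of_mem_nhdsWithin
      (mem_of_superset (Icc_mem_nhdsGE ht.2) (Icc_subset_Icc ht.1 le_rfl))
  -- comparison `c₀ E ≤ g ≤ c₁ E` on `[0, τ]`
  have hwS : ∀ t ∈ Icc 0 τ, ∀ y, (c₀ ≤ Acoef ζ (ρ t y) (ϑ t y) ∧ Acoef ζ (ρ t y) (ϑ t y) ≤ c₁) ∧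
      (c₀ ≤ ρ t y ∧ ρ t y ≤ c₁) ∧ (c₀ ≤ Ccoef (ρ t y) (ϑ t y) ∧ Ccoef (ρ t y) (ϑ t y) ≤ c₁) := fun t ht y =>
    hwK _ (hstate t (hsub ht) y)
  have hcmp : ∀ t ∈ Icc 0 τ, c₀ * levelEnergy ρ u ϑ m t ≤ g t ∧ g t ≤ c₁ * levelEnergy ρ u ϑ m t := by
    intro t ht
    simp only [hgdef, weightedLevelEnergy, levelEnergy, Finset.mul_sum]
    exact ⟨Finset.sum_le_sum fun n _ => Finset.sum_le_sum fun w _ =>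
        (weightedWordEnergy_compare hζ hsol hwS (List.ofFn w) ht).1,
      Finset.sum_le_sum fun n _ => Finset.sum_le_sum fun w _ =>
        (weightedWordEnergy_compare hζ hsol hwS (List.ofFn w) ht).2⟩
  have hgnn : ∀ t ∈ Icc 0 τ, 0 ≤ g t := fun t ht =>
    (mul_nonneg hc₀.le (levelEnergy_nonneg _ _)).trans (hcmp t ht).1
  -- (8) the bound on the derivative
  have hbound : ∀ t ∈ Ico 0 τ, ‖g' t‖ ≤ Kc * ‖g t‖ + εc := by
    intro t ht
    have htc : t ∈ Icc 0 τ := Ico_subset_Icc_self ht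
    have htT : t ∈ Ico 0 T := hsub htc
    obtain ⟨E, hEdef⟩ : ∃ E : ℝ, E = levelEnergy ρ u ϑ m t := ⟨_, rfl⟩
    have hE0 : 0 ≤ E := by rw [hEdef]; exact levelEnergy_nonneg _ _
    obtain ⟨X, hXdef⟩ : ∃ X : ℝ, X = Real.sqrt E := ⟨_, rfl⟩
    have hX0 : 0 ≤ X := by rw [hXdef]; exact Real.sqrt_nonneg _
    obtain ⟨Ξ, hΞdef⟩ : ∃ Ξ : ℝ, Ξ = Real.sqrt (KS * E) := ⟨_, rfl⟩
    have hΞ0 : 0 ≤ Ξ := by rw [hΞdef]; exact Real.sqrt_nonneg _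
    have hφst := hφs t htT
    have hφK : ∀ x, (primFields ρ u ϑ t PIdx.rho x, primFields ρ u ϑ t PIdx.theta x) ∈ K := fun x => hstate t htT x
    -- the level-`m` hypotheses at time `t`
    have hXb : ∀ (k : PIdx) (v : List (Fin 3)), v.length ≤ m →
        Real.sqrt (∫ x, iterPartialDeriv v (primFields ρ u ϑ t k) x ^ 2) ≤ X := fun k v hv => by
      rw [hXdef, hEdef]; exact Real.sqrt_le_sqrt (integral_sq_primFields_le hv t k)
    have hBb : ∀ (k : PIdx) (v : List (Fin 3)), v.length ≤ m - 1 →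
        Real.sqrt (∫ x, iterPartialDeriv v (primFields ρ u ϑ t k) x ^ 2) ≤ Bc := fun k v hv => by
      rw [hBcdef]; exact Real.sqrt_le_sqrt ((integral_sq_primFields_le hv t k).trans (hprev t htT))
    have hΞb : ∀ (k : PIdx) (v : List (Fin 3)), v.length ≤ m - 2 → ∀ x,
        |iterPartialDeriv v (primFields ρ u ϑ t k) x| ≤ Ξ := by
      intro k v hv x
      have h2 := hSob ρ ϑ u t hφst k v x
      have h3 : levelEnergy ρ u ϑ (v.length + 2) t ≤ E := by rw [hEdef]; exact levelEnergy_mono (by omega) t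
      calc |iterPartialDeriv v (primFields ρ u ϑ t k) x|
          = Real.sqrt (iterPartialDeriv v (primFields ρ u ϑ t k) x ^ 2) := (Real.sqrt_sq_eq_abs _).symm
        _ ≤ Real.sqrt (KS * E) := Real.sqrt_le_sqrt (h2.trans (mul_le_mul_of_nonneg_left h3 hKS.le))
        _ = Ξ := hΞdef.symm
    -- commutator bounds, per word
    have hXQ : X * (3 * X + Bc * Ξ + 1) ≤ (4 + Bc * Real.sqrt KS) * E + 1 := by
      have hΞ' : Ξ = Real.sqrt KS * X := by rw [hΞdef, hXdef, Real.sqrt_mul hKS.le]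
      have hXX : X * X = E := by rw [hXdef]; exact Real.mul_self_sqrt hE0
      have hX1 : X ≤ E + 1 := by rw [hXdef]; exact sqrt_le_add_one hE0
      have hb0 : 0 ≤ Bc * Real.sqrt KS := mul_nonneg hBc0 (Real.sqrt_nonneg KS)
      calc X * (3 * X + Bc * Ξ + 1) = (3 + Bc * Real.sqrt KS) * (X * X) + X := by rw [hΞ']; ring
        _ = (3 + Bc * Real.sqrt KS) * E + X := by rw [hXX]
        _ ≤ (3 + Bc * Real.sqrt KS) * E + (E + 1) := add_le_add le_rfl hX1
        _ = (4 + Bc * Real.sqrt KS) * E + 1 := by ring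
    have hP0 : 0 ≤ 3 * X + Bc * Ξ + 1 :=
      add_nonneg (add_nonneg (mul_nonneg (by norm_num) hX0) (mul_nonneg hBc0 hΞ0)) zero_le_one
    have hword : ∀ (n : ℕ) (w : Fin n → Fin 3), n ≤ m →
        |D (List.ofFn w) t| ≤ (L + 18 * L ^ 2) * wordEnergy ρ u ϑ (List.ofFn w) t +
          κ * ((4 + Bc * Real.sqrt KS) * E + 1) := by
      intro n w hn
      have hlen : (List.ofFn w).length ≤ m := by simpa using hn
      have key := abs_integral_timeDerivWithin_weighted_le hζ hτ hsol hΛ1 (fun s hs y => hKb s (hsub hs) y)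
        (fun s hs y => hMb s (hsub hs) y) (List.ofFn w) htc
      obtain ⟨hF, hG, hH⟩ := hΓσ ⟨⟨n, Nat.lt_succ_of_le hn⟩, w⟩ (primFields ρ u ϑ t) hφst hφK S Ξ Bc X hS1 hΞ0 hBc0 hX0
        (hSup t htT) hΞb hBb hXb
      simp only at hF hG hH
      obtain ⟨Q, hQdef⟩ : ∃ Q : ℝ, Q = Γ * S ^ (m + 1) * (3 * X + Bc * Ξ + 1) := ⟨_, rfl⟩
      have hΓ' : Γσ ⟨⟨n, Nat.lt_succ_of_le hn⟩, w⟩ * S ^ (m + 1) * (3 * X + Bc * Ξ + 1) ≤ Q := by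
        have := hΓσle ⟨⟨n, Nat.lt_succ_of_le hn⟩, w⟩
        have hq : 0 ≤ S ^ (m + 1) * (3 * X + Bc * Ξ + 1) := mul_nonneg (pow_nonneg hS0 _) hP0
        calc Γσ ⟨⟨n, Nat.lt_succ_of_le hn⟩, w⟩ * S ^ (m + 1) * (3 * X + Bc * Ξ + 1)
            = Γσ ⟨⟨n, Nat.lt_succ_of_le hn⟩, w⟩ * (S ^ (m + 1) * (3 * X + Bc * Ξ + 1)) := mul_assoc _ _ _
          _ ≤ Γ * (S ^ (m + 1) * (3 * X + Bc * Ξ + 1)) := mul_le_mul_of_nonneg_right this hq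
          _ = Γ * S ^ (m + 1) * (3 * X + Bc * Ξ + 1) := (mul_assoc _ _ _).symm
          _ = Q := hQdef.symm
      -- the three norms of `∂^w` fields are `≤ X`
      have nR : Real.sqrt (∫ y, iterPartialDeriv (List.ofFn w) (ρ t) y ^ 2) ≤ X := hXb PIdx.rho _ hlen
      have nΘ : Real.sqrt (∫ y, iterPartialDeriv (List.ofFn w) (ϑ t) y ^ 2) ≤ X := hXb PIdx.theta _ hlen
      have nU : ∀ k, Real.sqrt (∫ y, iterPartialDeriv (List.ofFn w) (fun y => u t y k) y ^ 2) ≤ X := fun k =>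
        hXb (PIdx.vel k) _ hlen
      have hsrc : Real.sqrt (∫ y, iterPartialDeriv (List.ofFn w) (ρ t) y ^ 2) *
            Real.sqrt (∫ y, ((FF (List.ofFn w)).map fun T => T.eval (primFields ρ u ϑ t) PIdx.rho PIdx.theta y).sum ^ 2) +
          (∑ k, Real.sqrt (∫ y, iterPartialDeriv (List.ofFn w) (fun y => u t y k) y ^ 2) *
            Real.sqrt (∫ y, ((GG ζ k (List.ofFn w)).map fun T => T.eval (primFields ρ u ϑ t) PIdx.rho PIdx.theta y).sum ^ 2)) +
          Real.sqrt (∫ y, iterPartialDeriv (List.ofFn w) (ϑ t) y ^ 2) *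
            Real.sqrt (∫ y, ((HH ζ (List.ofFn w)).map fun T => T.eval (primFields ρ u ϑ t) PIdx.rho PIdx.theta y).sum ^ 2)
          ≤ 5 * (X * Q) := by
        have h1 : _ ≤ X * Q := mul_le_mul nR (hF.trans hΓ') (Real.sqrt_nonneg _) hX0
        have h3 : _ ≤ X * Q := mul_le_mul nΘ (hH.trans hΓ') (Real.sqrt_nonneg _) hX0
        have h2 : ∀ k, _ ≤ X * Q := fun k => mul_le_mul (nU k) ((hG k).trans hΓ') (Real.sqrt_nonneg _) hX0
        have h2s : (∑ k, Real.sqrt (∫ y, iterPartialDeriv (List.ofFn w) (fun y => u t y k) y ^ 2) *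
            Real.sqrt (∫ y, ((GG ζ k (List.ofFn w)).map fun T => T.eval (primFields ρ u ϑ t) PIdx.rho PIdx.theta y).sum ^ 2))
            ≤ ∑ _k : Fin 3, X * Q := Finset.sum_le_sum fun k _ => h2 k
        simp only [Finset.sum_const, Finset.card_univ, Fintype.card_fin, nsmul_eq_mul, Nat.cast_ofNat] at h2s
        calc _ ≤ X * Q + 3 * (X * Q) + X * Q := add_le_add (add_le_add h1 h2s) h3
          _ = 5 * (X * Q) := by ring
      have hXQ' : X * Q ≤ Γ * S ^ (m + 1) * ((4 + Bc * Real.sqrt KS) * E + 1) := by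
        rw [hQdef]
        have : X * (Γ * S ^ (m + 1) * (3 * X + Bc * Ξ + 1)) = Γ * S ^ (m + 1) * (X * (3 * X + Bc * Ξ + 1)) := by ring
        rw [this]
        exact mul_le_mul_of_nonneg_left hXQ (mul_nonneg hΓ0 (pow_nonneg hS0 _))
      have key' : |D (List.ofFn w) t| ≤ (L + 18 * L ^ 2) * wordEnergy ρ u ϑ (List.ofFn w) t + 2 * L *
          (Real.sqrt (∫ y, iterPartialDeriv (List.ofFn w) (ρ t) y ^ 2) *
            Real.sqrt (∫ y, ((FF (List.ofFn w)).map fun T => T.eval (primFields ρ u ϑ t) PIdx.rho PIdx.theta y).sum ^ 2) +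
          (∑ k, Real.sqrt (∫ y, iterPartialDeriv (List.ofFn w) (fun y => u t y k) y ^ 2) *
            Real.sqrt (∫ y, ((GG ζ k (List.ofFn w)).map fun T => T.eval (primFields ρ u ϑ t) PIdx.rho PIdx.theta y).sum ^ 2)) +
          Real.sqrt (∫ y, iterPartialDeriv (List.ofFn w) (ϑ t) y ^ 2) *
            Real.sqrt (∫ y, ((HH ζ (List.ofFn w)).map fun T => T.eval (primFields ρ u ϑ t) PIdx.rho PIdx.theta y).sum ^ 2)) := by
        rw [← hLdef] at key
        exact key
      have e1 : 2 * L * (5 * (X * Q)) = 10 * L * (X * Q) := by ring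
      have e2 : 10 * L * Γ * S ^ (m + 1) * ((4 + Bc * Real.sqrt KS) * E + 1) =
          10 * L * (Γ * S ^ (m + 1) * ((4 + Bc * Real.sqrt KS) * E + 1)) := by ring
      calc |D (List.ofFn w) t| ≤ (L + 18 * L ^ 2) * wordEnergy ρ u ϑ (List.ofFn w) t + 2 * L * (5 * (X * Q)) :=
            key'.trans (add_le_add le_rfl (mul_le_mul_of_nonneg_left hsrc (mul_nonneg zero_le_two hL0)))
        _ ≤ (L + 18 * L ^ 2) * wordEnergy ρ u ϑ (List.ofFn w) t + κ * ((4 + Bc * Real.sqrt KS) * E + 1) := by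
            rw [hκ, e1, e2]
            exact add_le_add le_rfl (mul_le_mul_of_nonneg_left hXQ' (mul_nonneg (by norm_num : (0 : ℝ) ≤ 10) hL0))
    -- sum over the words
    have hsumD : |g' t| ≤ (L + 18 * L ^ 2) * E + κ * ((4 + Bc * Real.sqrt KS) * E + 1) * (levelCount m) := by
      show |∑ n ∈ Finset.range (m + 1), ∑ w : Fin n → Fin 3, D (List.ofFn w) t| ≤ _
      calc |∑ n ∈ Finset.range (m + 1), ∑ w : Fin n → Fin 3, D (List.ofFn w) t|
          ≤ ∑ n ∈ Finset.range (m + 1), ∑ w : Fin n → Fin 3, |D (List.ofFn w) t| :=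
            (Finset.abs_sum_le_sum_abs _ _).trans (Finset.sum_le_sum fun n _ => Finset.abs_sum_le_sum_abs _ _)
        _ ≤ ∑ n ∈ Finset.range (m + 1), ∑ w : Fin n → Fin 3,
            ((L + 18 * L ^ 2) * wordEnergy ρ u ϑ (List.ofFn w) t + κ * ((4 + Bc * Real.sqrt KS) * E + 1)) :=
            Finset.sum_le_sum fun n hn => Finset.sum_le_sum fun w _ =>
              hword n w (Nat.lt_succ_iff.1 (Finset.mem_range.1 hn))
        _ = ∑ n ∈ Finset.range (m + 1), ((L + 18 * L ^ 2) * (∑ w : Fin n → Fin 3, wordEnergy ρ u ϑ (List.ofFn w) t) +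
            κ * ((4 + Bc * Real.sqrt KS) * E + 1) * ((Finset.univ : Finset (Fin n → Fin 3)).card : ℝ)) := by
            refine Finset.sum_congr rfl fun n _ => ?_
            rw [Finset.sum_add_distrib, Finset.sum_const, nsmul_eq_mul, ← Finset.mul_sum,
              mul_comm ((Finset.univ : Finset (Fin n → Fin 3)).card : ℝ)]
        _ = (L + 18 * L ^ 2) * E + κ * ((4 + Bc * Real.sqrt KS) * E + 1) * (levelCount m) := by
            rw [Finset.sum_add_distrib, ← Finset.mul_sum, ← Finset.mul_sum]
            simp only [hEdef, levelEnergy, levelCount]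
    have hEg : E ≤ g t / c₀ := by rw [le_div_iff₀ hc₀, mul_comm, hEdef]; exact (hcmp t htc).1
    rw [Real.norm_eq_abs, Real.norm_eq_abs, abs_of_nonneg (hgnn t htc)]
    calc |g' t| ≤ (L + 18 * L ^ 2) * E + κ * ((4 + Bc * Real.sqrt KS) * E + 1) * (levelCount m) := hsumD
      _ ≤ K₁ * (levelCount m) * E + εc := by
          rw [hK₁, hεc]
          have key : (L + 18 * L ^ 2) * E ≤ (L + 18 * L ^ 2) * E * levelCount m :=
            le_mul_of_one_le_right (mul_nonneg hL18 hE0) hW1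
          calc (L + 18 * L ^ 2) * E + κ * ((4 + Bc * Real.sqrt KS) * E + 1) * levelCount m
              = (L + 18 * L ^ 2) * E + (κ * (4 + Bc * Real.sqrt KS) * levelCount m * E + κ * levelCount m) := by
                ring
            _ ≤ (L + 18 * L ^ 2) * E * levelCount m +
                (κ * (4 + Bc * Real.sqrt KS) * levelCount m * E + κ * levelCount m) := add_le_add key le_rfl
            _ = ((L + 18 * L ^ 2) + κ * (4 + Bc * Real.sqrt KS)) * levelCount m * E + κ * levelCount m := by
                ring
      _ ≤ Kc * g t + εc := by
          rw [hKcdef]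
          have hg0 := hgnn t htc
          have h1 : K₁ * (levelCount m) * E ≤ K₁ * (levelCount m) * (g t / c₀) :=
            mul_le_mul_of_nonneg_left hEg (mul_nonneg hK₁0 hW0)
          have h2 : K₁ * (levelCount m) * (g t / c₀) = K₁ * (levelCount m) / c₀ * g t := by ring
          rw [add_mul, one_mul, ← h2]
          exact add_le_add (h1.trans (le_add_of_nonneg_right hg0)) le_rfl
  -- (9) Grönwall on `[0, τ]` and the conclusion at `t₀`
  have h0τ : (0 : ℝ) ∈ Icc 0 τ := ⟨le_rfl, hτ.le⟩
  have hg0δ : ‖g 0‖ ≤ δ := by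
    rw [Real.norm_eq_abs, abs_of_nonneg (hgnn 0 h0τ), hδdef]; exact (hcmp 0 h0τ).2
  have hgron := norm_le_gronwallBound_of_norm_deriv_right_le hcont hderiv' hg0δ hbound t₀ ht₀τ
  simp only [gronwallBound_of_K_ne_0 hKc.ne', Real.norm_eq_abs, abs_of_nonneg (hgnn t₀ ht₀τ),
    sub_zero] at hgron
  have hexp : Real.exp (Kc * t₀) ≤ Real.exp (Kc * T) :=
    Real.exp_le_exp.2 (mul_le_mul_of_nonneg_left ht₀.2.le hKc.le)
  have hεK : 0 ≤ εc / Kc := div_nonneg hεc0 hKc.le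
  have hgT : g t₀ ≤ δ * Real.exp (Kc * T) + εc / Kc * (Real.exp (Kc * T) - 1) :=
    hgron.trans (add_le_add (mul_le_mul_of_nonneg_left hexp hδ0)
      (mul_le_mul_of_nonneg_left (sub_le_sub_right hexp 1) hεK))
  rw [le_div_iff₀ hc₀, mul_comm]
  exact ((hcmp t₀ ht₀τ).1).trans hgT

/-! ### The induction and the main theorem -/

/-- **Levels zero and one from the `C¹` bound.** [cite: Majda1984, Ch. 2 §2.1 Thm 2.2] -/
theorem levelEnergy_one_le {T : ℝ} (h : IsPrimitiveEulerSolutionOn (EulerEOS.monatomicExcess ζ f) (Ico 0 T) ρ u ϑ)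
    {Λ : ℝ}
    (hlow : ∀ t ∈ Ico 0 T, ∀ (k : PIdx) (v : List (Fin 3)), v.length ≤ 1 → ∀ x,
      |iterPartialDeriv v (primFields ρ u ϑ t k) x| ≤ Λ) :
    ∀ t ∈ Ico 0 T, levelEnergy ρ u ϑ 1 t ≤ 20 * Λ ^ 2 := by
  intro t ht
  have hφs := isSmooth_primFields h ht
  have hword : ∀ v : List (Fin 3), v.length ≤ 1 → wordEnergy ρ u ϑ v t ≤ 5 * Λ ^ 2 := by
    intro v hv
    have hb : ∀ k : PIdx, ∫ y, iterPartialDeriv v (primFields ρ u ϑ t k) y ^ 2 ≤ Λ ^ 2 := fun k =>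
      integral_sq_le_sq_of_abs_le (((hφs k).iterPartialDeriv v).continuous) (hlow t ht k v hv)
    unfold wordEnergy
    have h1 := hb PIdx.rho; have h2 := hb PIdx.theta; have h3 := fun k => hb (PIdx.vel k)
    simp only [primFields_rho, primFields_theta, primFields_vel] at h1 h2 h3
    have h3s : (∑ k, ∫ y, iterPartialDeriv v (fun y => u t y k) y ^ 2) ≤ ∑ _k : Fin 3, Λ ^ 2 :=
      Finset.sum_le_sum fun k _ => h3 k
    simp only [Finset.sum_const, Finset.card_univ, Fintype.card_fin, nsmul_eq_mul, Nat.cast_ofNat] at h3s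
    linarith
  unfold levelEnergy
  rw [Finset.sum_range_succ, Finset.sum_range_succ, Finset.sum_range_zero, zero_add]
  have h0 : ∑ w : Fin 0 → Fin 3, wordEnergy ρ u ϑ (List.ofFn w) t ≤ 5 * Λ ^ 2 := by
    rw [Fintype.sum_unique]
    exact hword _ (by simp)
  have h1 : ∑ w : Fin 1 → Fin 3, wordEnergy ρ u ϑ (List.ofFn w) t ≤ ∑ _w : Fin 1 → Fin 3, 5 * Λ ^ 2 :=
    Finset.sum_le_sum fun w _ => hword _ (by simp)
  simp only [Finset.sum_const, Finset.card_univ, Fintype.card_fun, Fintype.card_fin, nsmul_eq_mul,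
    Nat.cast_ofNat, pow_one] at h1
  linarith

/-- **All level energies are bounded on `[0, T)`** (induction on the level).
[cite: Majda1984, Ch. 2 §2.1 Thm 2.2 (2.38)] -/
theorem levelEnergy_bounded (hζ : ContDiff ℝ ∞ ζ) {T : ℝ} (hT : 0 < T)
    (h : IsPrimitiveEulerSolutionOn (EulerEOS.monatomicExcess ζ f) (Ico 0 T) ρ u ϑ)
    {K : Set (ℝ × ℝ)} (hK : IsCompact K)
    (hKhyp : K ⊆ {z : ℝ × ℝ | 0 < z.1 ∧ 0 < z.2 ∧ 0 < deriv (fun s => s * ζ s) z.1})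
    (hstate : ∀ t ∈ Ico 0 T, ∀ x, (ρ t x, ϑ t x) ∈ K)
    {M : ℝ} (hC1 : ∀ t ∈ Ico 0 T, ∀ x, ‖u t x‖ ≤ M ∧ ∀ i, |partialDeriv i (ρ t) x| ≤ M ∧
      ‖partialDeriv i (u t) x‖ ≤ M ∧ |partialDeriv i (ϑ t) x| ≤ M) :
    ∀ m : ℕ, ∃ C : ℝ, ∀ t ∈ Ico 0 T, levelEnergy ρ u ϑ m t ≤ C := by
  -- the `C¹`/state bound `Λ` for levels `0, 1`
  obtain ⟨B1, -, b1⟩ := exists_abs_le_of_continuousOn hK continuous_fst.continuousOn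
  obtain ⟨B2, -, b2⟩ := exists_abs_le_of_continuousOn hK continuous_snd.continuousOn
  set Λ : ℝ := B1 + B2 + |M| with hΛ
  have hB1 : 0 ≤ B1 := (abs_nonneg _).trans (b1 _ (hstate 0 ⟨le_rfl, hT⟩ 0))
  have hB2 : 0 ≤ B2 := (abs_nonneg _).trans (b2 _ (hstate 0 ⟨le_rfl, hT⟩ 0))
  have hΛ0 : 0 ≤ Λ := by rw [hΛ]; positivity
  have hlow : ∀ t ∈ Ico 0 T, ∀ (k : PIdx) (v : List (Fin 3)), v.length ≤ 1 → ∀ x,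
      |iterPartialDeriv v (primFields ρ u ϑ t k) x| ≤ Λ := by
    intro t ht k v hv x
    have hu1 : IsContDiff 1 (u t) := (h.smooth_velocity.isSmooth_slice ht).isContDiff (by simp)
    have hz := hstate t ht x
    have hM : M ≤ Λ := by rw [hΛ]; linarith [le_abs_self M]
    rcases list_length_le_one hv with rfl | ⟨i, rfl⟩
    · rcases k with _ | _ | k
      · show |ρ t x| ≤ Λ
        have : |(ρ t x, ϑ t x).1| ≤ B1 := b1 _ hz
        simp only at this; rw [hΛ]; linarith [abs_nonneg M]
      · show |ϑ t x| ≤ Λ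
        have : |(ρ t x, ϑ t x).2| ≤ B2 := b2 _ hz
        simp only at this; rw [hΛ]; linarith [abs_nonneg M]
      · simp only [iterPartialDeriv_nil, primFields]
        exact ((abs_apply_le_norm _ _).trans (hC1 t ht x).1).trans hM
    · rcases k with _ | _ | k
      · simpa using (((hC1 t ht x).2 i).1).trans hM
      · simpa using (((hC1 t ht x).2 i).2.2).trans hM
      · simp only [iterPartialDeriv_cons, iterPartialDeriv_nil, primFields]
        rw [partialDeriv_apply_coord hu1]
        exact ((abs_apply_le_norm _ _).trans ((hC1 t ht x).2 i).2.1).trans hM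
  have h1 := levelEnergy_one_le h hlow
  intro m
  induction m with
  | zero => exact ⟨20 * Λ ^ 2, fun t ht => (levelEnergy_mono (Nat.zero_le 1) t).trans (h1 t ht)⟩
  | succ m ih =>
    by_cases hm : m = 0
    · subst hm; exact ⟨20 * Λ ^ 2, h1⟩
    · obtain ⟨Cprev, hprev⟩ := ih
      have hm2 : 2 ≤ m + 1 := by omega
      exact levelEnergy_step hζ hT h hK hKhyp hstate hC1 hm2 (Cprev := Cprev)
        (fun t ht => by simpa using hprev t ht)

/-- **A-priori bounds of all spatial derivatives from a `C¹` bound** (the analytic half of the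
continuation principle, Majda 1984 Thm 2.2 / Dafermos 2005 Thm 5.1.1): a classical solution of
the compressible Euler system with the monatomic law `p = ρϑζ(ρ)`, `e = 3ϑ/2` on `[0, T) × 𝕋³`
whose state stays in a compact subset `K` of the hyperbolicity region
`{ρ > 0, ϑ > 0, (ρζ)' > 0}` and whose `C¹` size stays bounded has every spatial word derivative
of `(ρ, u, ϑ)` bounded on `[0, T) × 𝕋³`. [cite: Majda1984, Ch. 2 §2.1 Thm 2.2 (2.38)] -/
theorem IsClassicalEulerSolution.spatialWordBounds_of_C1 (hζ : ContDiff ℝ ∞ ζ) {T : ℝ} (hT : 0 < T)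
    (h : IsClassicalEulerSolution (EulerEOS.monatomicExcess ζ f) T ρ u ϑ)
    {K : Set (ℝ × ℝ)} (hK : IsCompact K)
    (hKhyp : K ⊆ {z : ℝ × ℝ | 0 < z.1 ∧ 0 < z.2 ∧ 0 < deriv (fun s => s * ζ s) z.1})
    (hstate : ∀ t ∈ Ico 0 T, ∀ x, (ρ t x, ϑ t x) ∈ K)
    {M : ℝ} (hC1 : ∀ t ∈ Ico 0 T, ∀ x, ‖u t x‖ ≤ M ∧ ∀ i, |partialDeriv i (ρ t) x| ≤ M ∧
      ‖partialDeriv i (u t) x‖ ≤ M ∧ |partialDeriv i (ϑ t) x| ≤ M) :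
    ∀ m : ℕ, ∃ C : ℝ, ∀ t ∈ Ico 0 T, ∀ x, ∀ l : List (Fin 3), l.length ≤ m →
      |iterPartialDeriv l (ρ t) x| ≤ C ∧ ‖iterPartialDeriv l (u t) x‖ ≤ C ∧
        |iterPartialDeriv l (ϑ t) x| ≤ C := by
  have hprim := h.primitive_monatomicExcess hζ
  obtain ⟨KS, hKS, hSob⟩ := exists_sobolev_const
  intro m
  obtain ⟨C, hC⟩ := levelEnergy_bounded hζ hT hprim hK hKhyp hstate hC1 (m + 2)
  have hC0 : 0 ≤ C := (levelEnergy_nonneg (ρ := ρ) (u := u) (ϑ := ϑ) (m + 2) 0).trans (hC 0 ⟨le_rfl, hT⟩)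
  refine ⟨3 * Real.sqrt (KS * C), fun t ht x l hl => ?_⟩
  have hφs := isSmooth_primFields hprim ht
  have hk : ∀ k : PIdx, |iterPartialDeriv l (primFields ρ u ϑ t k) x| ≤ Real.sqrt (KS * C) := by
    intro k
    have h2 := hSob ρ ϑ u t hφs k l x
    have h3 : levelEnergy ρ u ϑ (l.length + 2) t ≤ C := (levelEnergy_mono (by omega) t).trans (hC t ht)
    calc |iterPartialDeriv l (primFields ρ u ϑ t k) x| = Real.sqrt (iterPartialDeriv l (primFields ρ u ϑ t k) x ^ 2) :=
          (Real.sqrt_sq_eq_abs _).symm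
      _ ≤ Real.sqrt (KS * C) := Real.sqrt_le_sqrt (h2.trans (mul_le_mul_of_nonneg_left h3 hKS.le))
  have hs0 : 0 ≤ Real.sqrt (KS * C) := Real.sqrt_nonneg _
  refine ⟨(hk PIdx.rho).trans (by linarith), ?_, (hk PIdx.theta).trans (by linarith)⟩
  have hu : IsSmooth (u t) := hprim.smooth_velocity.isSmooth_slice ht
  calc ‖iterPartialDeriv l (u t) x‖ ≤ ∑ i, |iterPartialDeriv l (u t) x i| := norm_le_sum_abs _
    _ = ∑ i, |iterPartialDeriv l (fun y => u t y i) x| := by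
        refine Finset.sum_congr rfl fun i _ => ?_; rw [iterPartialDeriv_apply_coord hu]
    _ ≤ ∑ _i : Fin 3, Real.sqrt (KS * C) := Finset.sum_le_sum fun i _ => hk (PIdx.vel i)
    _ = 3 * Real.sqrt (KS * C) := by simp

end CompressibleEuler

end Literature.Analysis.FluidPDE

end
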